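import Literature.Computability.Cryptography.QuantumTuringMachineQSM
import HarnessLib

/-!
# The quantum stack machine: configurations, their encoding on the tape, and the simulation of one sweep

Sequel of `QuantumTuringMachineQSM.lean` (the sweep specification `QTM.QSM.Prog.spec` of a
program of the quantum stack machine and its machine `QTM.QSM.Prog.machine`). Here the
*abstract* machine is defined — configurations `QTM.QSM.Prog.Conf` (current instruction, stack
registers, history, qubit queue with its dead prefix, parked qubits) and the one-sweep step
`QTM.QSM.Prog.stepConf` (a finitely supported superposition of configurations: deterministic but
for `qgate`, which superposes the front qubits according to the gate matrix) — together with the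
encoding `QTM.QSM.Prog.enc n s` of a configuration as (control register, live cells) at the `s`-th
sweep boundary on inputs of length `n`, and it is PROVED that one sweep of the sweep machine on an
encoded configuration is the encoding of the abstract step (`QTM.QSM.Prog.dynStep_enc`), whence
the run theorem `QTM.QSM.Prog.dynRun_eq` and the acceptance probability of `P.machine` in terms of
the abstract run (`QTM.QSM.Prog.pacceptProbAt_eq`, `acceptProbAt_eq`).

The proof applies the list-level track lemmas of `QuantumTuringMachineTracks.lean` through the
lift `QTM.QSM.Prog.liftRule` (rightward pass: the history push committing the pending record,
independently the operation of the new instruction on its track — `scan_ruleR_run`; right turn: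
`turnσ` arms the record, then the gate on the parked qubits; leftward pass: pop / return), and
the geometry lemma `cells_succ`, following Bernstein–Vazirani 1997, §4 and Nishimura–Ozawa 2002,
Lemma 5.1. All proved; no named fact.

## References

* E. Bernstein, U. Vazirani, *Quantum complexity theory*, SIAM J. Comput. 26 (1997) 1411–1473
  [BernsteinVaziraniSICOMP1997]: §4, App. B.
* H. Nishimura, M. Ozawa, Theoret. Comput. Sci. 276 (2002) 147–181 [NishimuraOzawa2002]:
  Lemma 5.1.
-/

noncomputable section

namespace Literature.Computability.Cryptography

namespace QTM

namespace QSM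

namespace Prog

open Track SweepSpec
open scoped BigOperators ComplexConjugate

variable (P : Prog)

/-! ### Partial scans -/

section PScan

variable {Φ C : Type}

/-- The **partial scan** of a partial rule: defined iff every step is in the rule's domain. [folklore] -/
def pscan (spec : Φ × C → Option (Φ × C)) : Φ → List C → Option (Φ × List C)
  | φ, [] => some (φ, [])
  | φ, c :: cs =>
      match spec (φ, c) with
      | none => none
      | some y =>
          match pscan spec y.1 cs with
          | none => none
          | some z => some (z.1, y.2 :: z.2)

/-- `pscan` on the empty list. [folklore] -/
@[simp] theorem pscan_nil (spec : Φ × C → Option (Φ × C)) (φ : Φ) : pscan spec φ [] = some (φ, []) := rfl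

/-- `pscan` on a cons whose first step is defined. [folklore] -/
theorem pscan_cons_of_eq (spec : Φ × C → Option (Φ × C)) {φ : Φ} {c : C} {y : Φ × C} (h : spec (φ, c) = some y)
    (cs : List C) : pscan spec φ (c :: cs) = (pscan spec y.1 cs).map fun z => (z.1, y.2 :: z.2) := by
  simp only [pscan, h]
  cases pscan spec y.1 cs <;> rfl

/-- **A defined partial scan is the scan of any extension.** [folklore] -/
theorem scan_eq_of_pscan {spec : Φ × C → Option (Φ × C)} {r : Φ × C → Φ × C} (hr : Extends r spec)
    {φ : Φ} {cs : List C} {φ' : Φ} {cs' : List C} (h : pscan spec φ cs = some (φ', cs')) :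
    scan r φ cs = (φ', cs') := by
  induction cs generalizing φ φ' cs' with
  | nil => simp at h; obtain ⟨rfl, rfl⟩ := h; rfl
  | cons c cs ih =>
    cases hy : spec (φ, c) with
    | none => rw [pscan, hy] at h; simp at h
    | some y =>
      rw [pscan_cons_of_eq spec hy] at h
      cases hz : pscan spec y.1 cs with
      | none => rw [hz] at h; simp at h
      | some z =>
        rw [hz] at h
        simp only [Option.map_some, Option.some.injEq] at h
        obtain ⟨rfl⟩ := h
        rw [scan_cons, hr _ _ hy, ih hz]

/-- `pscan` of a concatenation. [folklore] -/
theorem pscan_append_of_eq (spec : Φ × C → Option (Φ × C)) {φ : Φ} {l₁ : List C} {φ₁ : Φ} {l₁' : List C}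
    (h₁ : pscan spec φ l₁ = some (φ₁, l₁')) (l₂ : List C) :
    pscan spec φ (l₁ ++ l₂) = (pscan spec φ₁ l₂).map fun z => (z.1, l₁' ++ z.2) := by
  induction l₁ generalizing φ φ₁ l₁' with
  | nil =>
    simp at h₁; obtain ⟨rfl, rfl⟩ := h₁
    rw [List.nil_append]
    cases hq : pscan spec φ l₂ <;> simp
  | cons c cs ih =>
    cases hy : spec (φ, c) with
    | none => rw [pscan, hy] at h₁; simp at h₁
    | some y =>
      rw [pscan_cons_of_eq spec hy] at h₁
      cases hz : pscan spec y.1 cs with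
      | none => rw [hz] at h₁; simp at h₁
      | some z =>
        rw [hz] at h₁
        simp only [Option.map_some, Option.some.injEq] at h₁
        obtain ⟨rfl⟩ := h₁
        rw [List.cons_append, pscan_cons_of_eq spec hy, ih hz]
        cases pscan spec z.1 l₂ <;> simp

/-- `pscan` over cells on which the rule is the identity in the current state. [folklore] -/
theorem pscan_of_fixed (spec : Φ × C → Option (Φ × C)) (φ : Φ) (l : List C) (h : ∀ c ∈ l, spec (φ, c) = some (φ, c)) :
    pscan spec φ l = some (φ, l) := by
  induction l with
  | nil => rfl
  | cons c cs ih =>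
    rw [pscan_cons_of_eq spec (h c (by simp)), ih fun c' hc' => h c' (by simp [hc'])]
    rfl

/-- `pscan` over a run of identical fixed cells. [folklore] -/
theorem pscan_replicate_of_fixed (spec : Φ × C → Option (Φ × C)) (φ : Φ) (c : C) (k : ℕ) (h : spec (φ, c) = some (φ, c)) :
    pscan spec φ (List.replicate k c) = some (φ, List.replicate k c) :=
  pscan_of_fixed spec φ _ fun c' hc' => by rw [List.eq_of_mem_replicate hc']; exact h

/-- `pscan` over cells each rewritten without changing the state. [folklore] -/
theorem pscan_map_of_fixed (spec : Φ × C → Option (Φ × C)) (φ : Φ) (l : List C) (f : C → C)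
    (h : ∀ c ∈ l, spec (φ, c) = some (φ, f c)) : pscan spec φ l = some (φ, l.map f) := by
  induction l with
  | nil => rfl
  | cons c cs ih =>
    rw [pscan_cons_of_eq spec (h c (by simp)), ih fun c' hc' => h c' (by simp [hc'])]
    rfl

/-- An invariant of the rule holds at the end of a defined partial scan. [folklore] -/
theorem pscan_invariant {spec : Φ × C → Option (Φ × C)} {β : Type} (f : Φ → β)
    (hf : ∀ x y, spec x = some y → f y.1 = f x.1) {φ : Φ} {cs : List C} {φ' : Φ} {cs' : List C}
    (h : pscan spec φ cs = some (φ', cs')) : f φ' = f φ := by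
  induction cs generalizing φ φ' cs' with
  | nil => simp at h; obtain ⟨rfl, -⟩ := h; rfl
  | cons c cs ih =>
    cases hy : spec (φ, c) with
    | none => rw [pscan, hy] at h; simp at h
    | some y =>
      rw [pscan_cons_of_eq spec hy] at h
      cases hz : pscan spec y.1 cs with
      | none => rw [hz] at h; simp at h
      | some z =>
        rw [hz] at h
        simp only [Option.map_some, Option.some.injEq] at h
        obtain ⟨rfl⟩ := h
        rw [ih hz, hf _ _ hy]

end PScan

/-! ### List lemmas for the rules of this file -/

section ListLemmas

open TSym Base

variable {α : Type}

/-- **Two-phase push, at the level of lists.** [cite: BernsteinVaziraniSICOMP1997, §4] -/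
theorem pscan_push₂ (a : Bool) (j k : ℕ) (body : List (Base Bool)) :
    pscan (pushSpec₂ a) Push2.seek (frees j ++ seg body ++ free :: frees k) =
      some (Push2.seek, frees j ++ seg (body ++ [sym a]) ++ frees k) := by
  obtain ⟨bs, b, hb⟩ : ∃ (bs : List (Base Bool)) (b : Base Bool), anc :: body = bs ++ [b] :=
    ⟨(anc :: body).dropLast, (anc :: body).getLast (by simp), (List.dropLast_append_getLast _).symm⟩
  have h1 : seg body = bs.map (cell · false) ++ [cell b true] := by rw [seg, hb, hatLast_append_singleton]
  have h2 : seg (body ++ [sym a]) = bs.map (cell · false) ++ [cell b false] ++ [cell (sym a) true] := by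
    rw [seg, ← List.cons_append, hb, hatLast_append_singleton]; simp
  rw [List.append_assoc, pscan_append_of_eq _ (pscan_replicate_of_fixed (pushSpec₂ a) Push2.seek free j rfl), h1,
    List.append_assoc,
    pscan_append_of_eq _ (pscan_map_of_fixed (pushSpec₂ a) Push2.seek (bs.map (cell · false)) id (fun c hc => by
      obtain ⟨b', -, rfl⟩ := List.mem_map.1 hc; rfl))]
  simp only [List.map_id, List.singleton_append, Option.map_map]
  rw [pscan_cons_of_eq _ (rfl : pushSpec₂ a (Push2.seek, cell b true) = _)]
  simp only
  rw [pscan_cons_of_eq _ (rfl : pushSpec₂ a (Push2.pend, free) = _)]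
  simp only
  rw [pscan_replicate_of_fixed (pushSpec₂ a) Push2.seek free k rfl, h2]
  simp [List.append_assoc]

/-- **Resting rotation, queue with at least two elements.** [cite: BernsteinVaziraniSICOMP1997, §4] -/
theorem pscan_rot₃_cons (j k d : ℕ) (a : Bool) (rest : List Bool) (hrest : rest ≠ []) :
    pscan rotSpec₃ Rot3.seek (frees j ++ seg (qbody d (a :: rest)) ++ free :: frees k) =
      some (Rot3.seek, frees j ++ seg (qbody (d + 1) (rest ++ [a])) ++ frees k) := by
  obtain ⟨mid, z, rfl⟩ : ∃ mid z, rest = mid ++ [z] :=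
    ⟨rest.dropLast, rest.getLast hrest, (List.dropLast_append_getLast hrest).symm⟩
  have hout : seg (qbody (d + 1) (mid ++ [z] ++ [a])) =
      cell anc false :: (List.replicate d (cell dead false) ++ cell dead false ::
        (mid.map (fun x => cell (sym x) false) ++ [cell (sym z) false] ++ [cell (sym a) true])) := by
    have : anc :: qbody (d + 1) (mid ++ [z] ++ [a]) =
        (anc :: (List.replicate d dead ++ dead :: (mid.map sym ++ [sym z]))) ++ [sym a] := by
      simp [qbody, List.map_append, List.replicate_succ', List.append_assoc]
    rw [seg, this, hatLast_append_singleton]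
    simp [List.map_append, List.map_replicate, List.append_assoc]
  rw [hout, List.append_assoc, pscan_append_of_eq _ (pscan_replicate_of_fixed rotSpec₃ Rot3.seek free j rfl),
    seg_qbody_cons_append_singleton, List.cons_append, pscan_cons_of_eq _ (rfl : rotSpec₃ (Rot3.seek, cell anc false) = _)]
  simp only [Option.map_map, List.append_assoc]
  rw [pscan_append_of_eq _ (pscan_replicate_of_fixed rotSpec₃ Rot3.seek (cell dead false) d rfl)]
  simp only [List.cons_append, Option.map_map]
  rw [pscan_cons_of_eq _ (rfl : rotSpec₃ (Rot3.seek, cell (sym a) false) = _)]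
  simp only [Option.map_map, List.append_assoc]
  rw [pscan_append_of_eq _ (pscan_map_of_fixed rotSpec₃ (Rot3.carry a) (mid.map fun x => cell (sym x) false) id (fun c hc => by
      obtain ⟨x, -, rfl⟩ := List.mem_map.1 hc; rfl))]
  simp only [List.map_id, List.singleton_append, Option.map_map]
  rw [pscan_cons_of_eq _ (rfl : rotSpec₃ (Rot3.carry a, cell (sym z) true) = _)]
  simp only [Option.map_map]
  rw [pscan_cons_of_eq _ (rfl : rotSpec₃ (Rot3.pend a, free) = _)]
  simp only [Option.map_map]
  rw [pscan_replicate_of_fixed rotSpec₃ Rot3.seek free k rfl]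
  simp [List.append_assoc, Function.comp_def]

/-- **Resting rotation of a singleton queue.** [cite: BernsteinVaziraniSICOMP1997, §4] -/
theorem pscan_rot₃_singleton (j k d : ℕ) (a : Bool) :
    pscan rotSpec₃ Rot3.seek (frees j ++ seg (qbody d [a]) ++ free :: frees k) =
      some (Rot3.seek, frees j ++ seg (qbody (d + 1) [a]) ++ frees k) := by
  have hin : seg (qbody d [a]) = cell anc false :: (List.replicate d (cell dead false) ++ [cell (sym a) true]) := by
    have : anc :: qbody d [a] = (anc :: List.replicate d dead) ++ [sym a] := by simp [qbody]
    rw [seg, this, hatLast_append_singleton]; simp [List.map_replicate]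
  have hout : seg (qbody (d + 1) [a]) =
      cell anc false :: (List.replicate d (cell dead false) ++ [cell dead false] ++ [cell (sym a) true]) := by
    have : anc :: qbody (d + 1) [a] = (anc :: (List.replicate d dead ++ [dead])) ++ [sym a] := by
      simp [qbody, List.replicate_succ']
    rw [seg, this, hatLast_append_singleton]; simp [List.map_replicate]
  rw [List.append_assoc, pscan_append_of_eq _ (pscan_replicate_of_fixed rotSpec₃ Rot3.seek free j rfl), hin, List.cons_append,
    pscan_cons_of_eq _ (rfl : rotSpec₃ (Rot3.seek, cell anc false) = _)]
  simp only [Option.map_map, List.append_assoc]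
  rw [pscan_append_of_eq _ (pscan_replicate_of_fixed rotSpec₃ Rot3.seek (cell dead false) d rfl)]
  simp only [List.singleton_append, Option.map_map]
  rw [pscan_cons_of_eq _ (rfl : rotSpec₃ (Rot3.seek, cell (sym a) true) = _)]
  simp only [Option.map_map]
  rw [pscan_cons_of_eq _ (rfl : rotSpec₃ (Rot3.pend a, free) = _)]
  simp only [Option.map_map]
  rw [pscan_replicate_of_fixed rotSpec₃ Rot3.seek free k rfl, hout]
  simp [List.append_assoc, Function.comp_def]

/-- **Read, at the level of lists** (queue with at least two elements): the front goes into the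
register, its cell dies. [cite: NishimuraOzawa2002, Lemma 5.1] -/
theorem pscan_read_cons (j k d : ℕ) (a : Bool) (rest : List Bool) (hrest : rest ≠ []) :
    pscan readSpec [] (frees j ++ seg (qbody d (a :: rest)) ++ frees k) =
      some ([a], frees j ++ seg (qbody (d + 1) rest) ++ frees k) := by
  have hin : seg (qbody d (a :: rest)) =
      cell anc false :: (List.replicate d (cell dead false) ++ cell (sym a) false :: symCells (annotSyms rest)) := by
    rw [seg_qbody_of_ne_nil d (by simp : a :: rest ≠ []), show a :: rest = [a] ++ rest from rfl,
      annotSyms_append_of_ne_nil _ hrest]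
    simp
  have hout : seg (qbody (d + 1) rest) =
      cell anc false :: (List.replicate d (cell dead false) ++ cell dead false :: symCells (annotSyms rest)) := by
    rw [seg_qbody_of_ne_nil (d + 1) hrest, List.replicate_succ']
    simp
  rw [hin, hout, List.append_assoc, pscan_append_of_eq _ (pscan_replicate_of_fixed readSpec [] free j rfl),
    List.cons_append, pscan_cons_of_eq _ (rfl : readSpec ([], cell anc false) = _)]
  simp only [List.append_assoc, Option.map_map]
  rw [pscan_append_of_eq _ (pscan_replicate_of_fixed readSpec [] (cell dead false) d rfl)]
  simp only [List.cons_append, Option.map_map]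
  rw [pscan_cons_of_eq _ (rfl : readSpec ([], cell (sym a) false) = _)]
  simp only [Option.map_map]
  have hpass : ∀ ps : List (Bool × Bool), pscan readSpec [a] (symCells ps) = some ([a], symCells ps) := fun ps =>
    pscan_of_fixed readSpec _ _ fun c hc => by obtain ⟨p, -, rfl⟩ := List.mem_map.1 hc; rfl
  rw [pscan_append_of_eq _ (hpass _)]
  simp only [Option.map_map]
  rw [pscan_replicate_of_fixed readSpec [a] free k rfl]
  simp [List.append_assoc, Function.comp_def]

/-- **Read a singleton queue**: the dying cell keeps the hat. [cite: NishimuraOzawa2002, Lemma 5.1] -/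
theorem pscan_read_singleton (j k d : ℕ) (a : Bool) :
    pscan readSpec [] (frees j ++ seg (qbody d [a]) ++ frees k) =
      some ([a], frees j ++ seg (qbody (d + 1) []) ++ frees k) := by
  have hin : seg (qbody d [a]) = cell anc false :: (List.replicate d (cell dead false) ++ [cell (sym a) true]) := by
    have : anc :: qbody d [a] = (anc :: List.replicate d dead) ++ [sym a] := by simp [qbody]
    rw [seg, this, hatLast_append_singleton]; simp [List.map_replicate]
  have hout : seg (qbody (d + 1) ([] : List Bool)) = cell anc false :: (List.replicate d (cell dead false) ++ [cell dead true]) := by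
    have : anc :: qbody (d + 1) ([] : List Bool) = (anc :: List.replicate d dead) ++ [dead] := by
      simp [qbody, List.replicate_succ']
    rw [seg, this, hatLast_append_singleton]; simp [List.map_replicate]
  rw [List.append_assoc, pscan_append_of_eq _ (pscan_replicate_of_fixed readSpec [] free j rfl), hin, List.cons_append,
    pscan_cons_of_eq _ (rfl : readSpec ([], cell anc false) = _)]
  simp only [Option.map_map, List.append_assoc]
  rw [pscan_append_of_eq _ (pscan_replicate_of_fixed readSpec [] (cell dead false) d rfl)]
  simp only [List.singleton_append, Option.map_map]
  rw [pscan_cons_of_eq _ (rfl : readSpec ([], cell (sym a) true) = _)]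
  simp only [Option.map_map]
  rw [pscan_replicate_of_fixed readSpec [a] free k rfl, hout]
  simp [List.append_assoc, Function.comp_def]

end ListLemmas

/-! ### The history push with commit, at the level of lists -/

/-- **The history push**, at the level of lists: from `(false, cur, some r)` with `r.1 = cur`,
over `frees j ++ seg (hist) ++ free :: frees k`: the top is unhatted, the record `r` written hatted
on the next cell, and the commit takes place — `(false, next r, none)`. [cite: BernsteinVaziraniSICOMP1997, §4] -/
theorem pscan_h (j k : ℕ) (hist : List P.Rec) (cur : P.PC) (r : P.Rec) (hr : r.1 = cur) :
    pscan (P.hSpec P.next) (false, cur, some r) (frees j ++ seg (hist.map Base.sym) ++ TSym.free :: frees k) =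
      some ((false, P.next r, none), frees j ++ seg (hist.map Base.sym ++ [Base.sym r]) ++ frees k) := by
  obtain ⟨bs, b, hb⟩ : ∃ (bs : List (Base P.Rec)) (b : Base P.Rec), Base.anc :: hist.map Base.sym = bs ++ [b] :=
    ⟨(Base.anc :: hist.map Base.sym).dropLast, (Base.anc :: hist.map Base.sym).getLast (by simp),
      (List.dropLast_append_getLast _).symm⟩
  have h1 : seg (hist.map Base.sym) = bs.map (TSym.cell · false) ++ [TSym.cell b true] := by
    rw [seg, hb, hatLast_append_singleton]
  have h2 : seg (hist.map Base.sym ++ [Base.sym r]) =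
      bs.map (TSym.cell · false) ++ [TSym.cell b false] ++ [TSym.cell (Base.sym r) true] := by
    rw [seg, ← List.cons_append, hb, hatLast_append_singleton]; simp
  rw [h1, h2, List.append_assoc,
    pscan_append_of_eq _ (pscan_replicate_of_fixed (P.hSpec P.next) (false, cur, some r) TSym.free j rfl),
    List.append_assoc,
    pscan_append_of_eq _ (pscan_map_of_fixed (P.hSpec P.next) (false, cur, some r) (bs.map (TSym.cell · false)) id
      (fun c hc => by obtain ⟨b', -, rfl⟩ := List.mem_map.1 hc; rfl))]
  simp only [List.map_id, List.singleton_append, Option.map_map]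
  rw [pscan_cons_of_eq _ (rfl : P.hSpec P.next ((false, cur, some r), TSym.cell b true) = _)]
  simp only [Option.map_map]
  rw [pscan_cons_of_eq _ (by simp [hSpec, hr] :
    P.hSpec P.next ((true, cur, some r), TSym.free) = some ((false, P.next r, none), TSym.cell (Base.sym r) true))]
  simp only [Option.map_map]
  rw [pscan_replicate_of_fixed (P.hSpec P.next) (false, P.next r, none) TSym.free k rfl]
  simp [List.append_assoc, Function.comp_def]

/-! ### The rightward pass: the history part and the operating part commute -/

/-- The effective instruction of a history state. [folklore] -/
def ecurOf (sH : P.HSt) : P.PC :=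
  match sH.2.2 with
  | some r => P.next r
  | none => sH.2.1

/-- The effective instruction of an `encH`-written register is that of the history state. [folklore] -/
theorem ecur_encH (ψ : P.Reg) (sH : P.HSt) : P.ecur (P.encH ψ sH) = P.ecurOf sH := by
  obtain ⟨a, b, c⟩ := sH; cases c <;> rfl

/-- On its domain the history rule preserves the effective instruction (history-state form). [folklore] -/
theorem ecurOf_of_hSpec {x y : P.HSt × TSym P.HSym} (h : P.hSpec P.next x = some y) : P.ecurOf y.1 = P.ecurOf x.1 :=
  P.hSpec_ecur P.next h

/-- A lift acting on the operating components commutes with writing the history components. [folklore] -/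
theorem liftRule_encH_setH {S α : Type} (perm : S × TSym α → S × TSym α) (dec : P.Reg → Option S)
    (enc : P.Reg → S → P.Reg) (get : P.Cell → TSym α) (set : P.Cell → TSym α → P.Cell)
    (hdec : ∀ φ sH, dec (P.encH φ sH) = dec φ) (henc : ∀ φ sH s, enc (P.encH φ sH) s = P.encH (enc φ s) sH)
    (hget : ∀ c t, get (P.setH c t) = get c) (hset : ∀ c t u, set (P.setH c t) u = P.setH (set c u) t)
    (x : P.Reg × P.Cell) (sH : P.HSt) (t : TSym P.HSym) :
    liftRule perm dec enc get set (P.encH x.1 sH, P.setH x.2 t) =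
      (P.encH (liftRule perm dec enc get set x).1 sH, P.setH (liftRule perm dec enc get set x).2 t) := by
  unfold liftRule
  rw [hdec]
  cases dec x.1 with
  | none => rfl
  | some s₀ =>
    simp only
    rw [hget, henc, hset]

/-- **The operation of an instruction commutes with writing the history components.** [folklore] -/
theorem opRAt_encH_setH (e : P.PC) (x : P.Reg × P.Cell) (sH : P.HSt) (t : TSym P.HSym) :
    P.opRAt e (P.encH x.1 sH, P.setH x.2 t) = (P.encH (P.opRAt e x).1 sH, P.setH (P.opRAt e x).2 t) := by
  unfold opRAt
  rcases P.instr e with _ | ⟨k, b⟩ | ⟨k, j⟩ | j | ⟨b, j⟩ | j | ⟨g, j⟩ | j <;> simp only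
  · exact P.liftRule_encH_setH _ _ _ _ _ (fun _ _ => rfl) (fun _ _ s => by cases s <;> rfl) (fun _ _ => rfl)
      (fun c t u => by obtain ⟨c1, c2, c3, c4⟩ := c; rfl) x sH t
  · exact P.liftRule_encH_setH _ _ _ _ _ (fun _ _ => rfl) (fun _ _ s => by cases s <;> rfl) (fun _ _ => rfl)
      (fun _ _ _ => rfl) x sH t
  · exact P.liftRule_encH_setH _ _ _ _ _ (fun _ _ => rfl) (fun _ _ s => by cases s <;> rfl) (fun _ _ => rfl)
      (fun _ _ _ => rfl) x sH t
  · exact P.liftRule_encH_setH _ _ _ _ _ (fun _ _ => rfl) (fun _ _ _ => rfl) (fun _ _ => rfl) (fun _ _ _ => rfl) x sH t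
  · exact P.liftRule_encH_setH _ _ _ _ _ (fun _ _ => rfl) (fun _ _ _ => rfl) (fun _ _ => rfl) (fun _ _ _ => rfl) x sH t

/-- **The rightward pass on a run register**: the history part (a defined partial scan of the
history rule over the history column) and the operating part of the (constant) effective
instruction proceed independently. [cite: BernsteinVaziraniSICOMP1997, §4] -/
theorem scan_ruleR_run (e : P.PC) (cs : List P.Cell) :
    ∀ (ψ : P.Reg) (sH sH' : P.HSt) (colH : List (TSym P.HSym)),
      ψ.ini = false → P.ecurOf sH = e →
      pscan (P.hSpec P.next) sH (cs.map P.getH) = some (sH', colH) →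
      scan P.spec.ruleR (P.encH ψ sH) cs =
        (P.encH (scan (P.opRAt e) ψ cs).1 sH', List.zipWith P.setH (scan (P.opRAt e) ψ cs).2 colH) := by
  induction cs with
  | nil =>
    intro ψ sH sH' colH _ _ h
    simp at h; obtain ⟨rfl, rfl⟩ := h; rfl
  | cons c cs ih =>
    intro ψ sH sH' colH hini he h
    rw [List.map_cons] at h
    cases hy : P.hSpec P.next (sH, P.getH c) with
    | none => rw [pscan, hy] at h; simp at h
    | some y =>
      rw [pscan_cons_of_eq _ hy] at h
      cases hz : pscan (P.hSpec P.next) y.1 (cs.map P.getH) with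
      | none => rw [hz] at h; simp at h
      | some z =>
        rw [hz] at h
        simp only [Option.map_some, Option.some.injEq] at h
        obtain ⟨rfl⟩ := h
        -- the step: history part, then the operation of `e`
        have hstep : P.spec.ruleR (P.encH ψ sH, c) = (P.encH (P.opRAt e (ψ, c)).1 y.1, P.setH (P.opRAt e (ψ, c)).2 y.2) := by
          show P.ruleRFun (P.encH ψ sH, c) = _
          unfold ruleRFun
          rw [if_neg (by show ¬ (P.encH ψ sH).ini = true; simp [encH, hini])]
          have hH : P.hR (P.encH ψ sH, c) = (P.encH ψ y.1, P.setH c y.2) := by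
            unfold hR
            rw [liftRule_enc P.liftLaws_H ψ (ψ.mh, ψ.cur, ψ.last) rfl sH c]
            show (P.encH ψ (P.hPerm (sH, P.getH c)).1, P.setH c (P.hPerm (sH, P.getH c)).2) = _
            rw [show P.hPerm (sH, P.getH c) = y from completeRule_apply _ hy]
          rw [hH]
          unfold opRFun
          rw [ecur_encH, P.ecurOf_of_hSpec hy, he]
          exact P.opRAt_encH_setH e (ψ, c) y.1 y.2
        rw [scan_cons, hstep]
        simp only
        have hini' : (P.opRAt e (ψ, c)).1.ini = false := by rw [opRAt_ini]; exact hini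
        have he' : P.ecurOf y.1 = e := by rw [P.ecurOf_of_hSpec hy]; exact he
        rw [ih _ _ _ _ hini' he' hz, scan_cons]
        simp

/-! ### Configurations of the abstract machine -/

/-- **Configurations of the quantum stack machine** at a sweep boundary: the current instruction,
the stack registers (top first), the history (chronological), the qubit queue (front first) with
the number of dead cells before it, the parked qubits. [cite: NishimuraOzawa2002, Lemma 5.1] -/
structure Conf where
  cur : P.PC
  res : PopRes
  regs : Fin P.K → List Bool
  hist : List P.HSym
  queue : List Bool
  dead : ℕ
  parked : List Bool

/-- The initial configuration on input `x` (first boundary): instruction `0`, the input register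
`U` holding `1^{|x|+1}`, empty history, the queue `x` followed by the dummy qubit `|0⟩`. [cite: NishimuraOzawa2002, Lemma 5.1] -/
def conf₁ (x : List Bool) : P.Conf where
  cur := 0
  res := PopRes.notpop
  regs := fun k => if k = P.U then List.replicate (x.length + 1) true else []
  hist := []
  queue := x ++ [false]
  dead := 0
  parked := []

/-- **Committing** the pending record: the history grows by it, its next instruction becomes
current (the first thing a sweep does, during the rightward pass). [cite: BernsteinVaziraniSICOMP1997, §4] -/
def commit (c : P.Conf) : P.Conf :=
  { c with cur := P.next (c.cur, c.res), hist := c.hist ++ [(c.cur, c.res)] }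

/-- **One sweep of the abstract machine**, as a finitely supported superposition of
configurations: commit the pending record, then execute the (new) current instruction — all
deterministic but `qgate`, which superposes the front `arity g` qubits with the amplitudes of the
gate matrix — leaving its own record pending. [cite: NishimuraOzawa2002, Lemma 5.1] -/
def stepConf (c₀ : P.Conf) : P.Conf →₀ ℂ :=
  let c := P.commit c₀
  match P.instr c.cur with
  | none => Finsupp.single { c with res := PopRes.notpop } 1
  | some (QInstr.push k b) =>
      Finsupp.single { c with res := PopRes.notpop, regs := Function.update c.regs k (b :: c.regs k) } 1
  | some (QInstr.pop k _) =>
      Finsupp.single { c with res := PopRes.popped (c.regs k).head?, regs := Function.update c.regs k (c.regs k).tail } 1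
  | some (QInstr.goto _) => Finsupp.single { c with res := PopRes.notpop } 1
  | some (QInstr.qpush b _) => Finsupp.single { c with res := PopRes.notpop, queue := c.queue ++ [b] } 1
  | some (QInstr.qrot _) =>
      Finsupp.single { c with res := PopRes.notpop, queue := c.queue.tail ++ c.queue.take 1, dead := c.dead + 1 } 1
  | some (QInstr.qgate g _) =>
      if h : P.G.arity g ≤ c.queue.length then
        ∑ z : QReg (P.G.arity g),
          Finsupp.single { c with res := PopRes.notpop, queue := List.ofFn z ++ c.queue.drop (P.G.arity g) }
            (P.G.mat g z (vecOf (c.queue.take (P.G.arity g)) (List.length_take_of_le h)))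
      else 0
  | some (QInstr.qread _) =>
      Finsupp.single
        { c with res := PopRes.notpop, queue := c.queue.tail, dead := c.dead + 1, parked := c.queue.take 1 } 1

/-! ### The encoding of a configuration on the tape -/

/-- The qubit column at boundary `s` on inputs of length `n` (live cells `-s, …, n+s-1`, the
anchor at `-1` = index `s-1`). [cite: NishimuraOzawa2002, Lemma 5.1] -/
def qcol (n s : ℕ) (c : P.Conf) : List (TSym Bool) :=
  frees (s - 1) ++ seg (qbody c.dead c.queue) ++ frees (n + s - c.dead - c.queue.length)

/-- The column of stack register `k`. [cite: BernsteinVaziraniSICOMP1997, §4] -/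
def rcol (n s : ℕ) (c : P.Conf) (k : Fin P.K) : List (TSym Bool) :=
  frees (s - 1) ++ seg ((c.regs k).reverse.map Base.sym) ++ frees (n + s - (c.regs k).length)

/-- The history column: a stack anchored at the left anchor (records pushed rightward during the
rightward passes). [cite: BernsteinVaziraniSICOMP1997, §4] -/
def hcol (n s : ℕ) (c : P.Conf) : List (TSym P.HSym) :=
  frees (s - 1) ++ seg (c.hist.map Base.sym) ++ frees (n + s - c.hist.length)

/-- The tag column: the right anchor at position `n` = index `n + s`. [folklore] -/
def tagcol (n s : ℕ) : List Bool :=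
  List.replicate (n + s) false ++ [true] ++ List.replicate (s - 1) false

/-- **The live cells** encoding the configuration `c` at boundary `s`. [cite: NishimuraOzawa2002, Lemma 5.1] -/
def cells (n s : ℕ) (c : P.Conf) : List P.Cell :=
  List.ofFn fun i : Fin (n + 2 * s) =>
    ⟨(tagcol n s).getD i false, (P.qcol n s c).getD i TSym.free, (P.hcol n s c).getD i TSym.free,
      fun k => (P.rcol n s c k).getD i TSym.free⟩

/-- **The control register** encoding `c` at a boundary: run mode, the executed instruction with
its pending record, history flag down, micro-state idle, the parked qubits. [cite: NishimuraOzawa2002, Lemma 5.1] -/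
def reg (c : P.Conf) : P.Reg :=
  ⟨false, c.cur, some (c.cur, c.res), false, Micro.idle, ⟨c.parked.take P.amax, by simp⟩⟩

/-- The encoding of a configuration as (control register, live cells). [cite: NishimuraOzawa2002, Lemma 5.1] -/
def enc (n s : ℕ) (c : P.Conf) : P.Reg × List P.Cell := (P.reg c, P.cells n s c)

/-- **Size invariants** of a configuration at boundary `s`: everything fits in the live region. [folklore] -/
structure Fits (n s : ℕ) (c : P.Conf) : Prop where
  one_le : 1 ≤ s
  queue_le : c.dead + c.queue.length ≤ n + s
  regs_le : ∀ k, (c.regs k).length ≤ n + s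
  hist_eq : c.hist.length = s - 1
  parked_le : c.parked.length ≤ P.amax

/-! ### Columns and cells -/

section Columns

variable {β : Type}

/-- `List.ofFn` of `getD` over the indices recovers the list. [folklore] -/
theorem ofFn_getD {w : ℕ} (l : List β) (d : β) (hl : l.length = w) :
    (List.ofFn fun i : Fin w => l.getD i d) = l := by
  subst hl
  refine List.ext_getElem (by simp) fun i h₁ h₂ => ?_
  rw [List.getElem_ofFn]
  simp [List.getD_eq_getElem?_getD, List.getElem?_eq_getElem h₂]

/-- `zipWith` against `List.ofFn`. [folklore] -/
theorem zipWith_ofFn {γ δ : Type} {w : ℕ} (f : γ → β → δ) (g : Fin w → γ) (l : List β) (d : β) (hl : l.length = w) :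
    List.zipWith f (List.ofFn g) l = List.ofFn fun i => f (g i) (l.getD i d) := by
  subst hl
  refine List.ext_getElem (by simp) fun i h₁ h₂ => ?_
  rw [List.getElem_zipWith, List.getElem_ofFn, List.getElem_ofFn]
  simp only [List.length_zipWith, List.length_ofFn] at h₁
  simp [List.getD_eq_getElem?_getD, List.getElem?_eq_getElem (show i < l.length by omega)]

end Columns

variable {n s : ℕ}

/-- Length of the qubit column. [folklore] -/
theorem length_qcol (c : P.Conf) (h : c.dead + c.queue.length ≤ n + s) (hs : 1 ≤ s) :
    (P.qcol n s c).length = n + 2 * s := by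
  simp [qcol, qbody]; omega

/-- Length of a stack column. [folklore] -/
theorem length_rcol (c : P.Conf) (k : Fin P.K) (h : (c.regs k).length ≤ n + s) (hs : 1 ≤ s) :
    (P.rcol n s c k).length = n + 2 * s := by
  simp [rcol]; omega

/-- Length of the history column. [folklore] -/
theorem length_hcol (c : P.Conf) (h : c.hist.length ≤ n + s) (hs : 1 ≤ s) :
    (P.hcol n s c).length = n + 2 * s := by
  simp [hcol]; omega

/-- Length of the tag column. [folklore] -/
theorem length_tagcol (hs : 1 ≤ s) : (tagcol n s).length = n + 2 * s := by
  simp [tagcol]; omega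

/-- The qubit track of the cells is the qubit column. [folklore] -/
theorem map_getQ_cells (c : P.Conf) (h : c.dead + c.queue.length ≤ n + s) (hs : 1 ≤ s) :
    (P.cells n s c).map P.getQ = P.qcol n s c := by
  rw [cells, List.map_ofFn]
  exact ofFn_getD _ _ (P.length_qcol c h hs)

/-- The history track of the cells is the history column. [folklore] -/
theorem map_getH_cells (c : P.Conf) (h : c.hist.length ≤ n + s) (hs : 1 ≤ s) :
    (P.cells n s c).map P.getH = P.hcol n s c := by
  rw [cells, List.map_ofFn]
  exact ofFn_getD _ _ (P.length_hcol c h hs)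

/-- A stack track of the cells is the stack column. [folklore] -/
theorem map_getR_cells (c : P.Conf) (k : Fin P.K) (h : (c.regs k).length ≤ n + s) (hs : 1 ≤ s) :
    (P.cells n s c).map (P.getR k) = P.rcol n s c k := by
  rw [cells, List.map_ofFn]
  exact ofFn_getD _ _ (P.length_rcol c k h hs)

/-- Rewriting the qubit track of the cells by the qubit column of a configuration with the same
other columns gives its cells. [folklore] -/
theorem zipWith_setQ_cells (c c' : P.Conf) (hh : c'.hist = c.hist) (hr : c'.regs = c.regs)
    (hlen : (P.qcol n s c').length = n + 2 * s) :
    List.zipWith P.setQ (P.cells n s c) (P.qcol n s c') = P.cells n s c' := by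
  rw [cells, zipWith_ofFn _ _ _ TSym.free hlen, cells]
  congr 1; funext i
  simp [setQ, hcol, rcol, hh, hr]

/-- Rewriting the history track likewise. [folklore] -/
theorem zipWith_setH_cells (c c' : P.Conf) (hq : c'.queue = c.queue) (hd : c'.dead = c.dead) (hr : c'.regs = c.regs)
    (hlen : (P.hcol n s c').length = n + 2 * s) :
    List.zipWith P.setH (P.cells n s c) (P.hcol n s c') = P.cells n s c' := by
  rw [cells, zipWith_ofFn _ _ _ TSym.free hlen, cells]
  congr 1; funext i
  simp [setH, qcol, rcol, hq, hd, hr]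

/-- Rewriting a stack track likewise. [folklore] -/
theorem zipWith_setR_cells (c c' : P.Conf) (k : Fin P.K) (hq : c'.queue = c.queue) (hd : c'.dead = c.dead)
    (hh : c'.hist = c.hist) (hr : ∀ k', k' ≠ k → c'.regs k' = c.regs k') (hlen : (P.rcol n s c' k).length = n + 2 * s) :
    List.zipWith (P.setR k) (P.cells n s c) (P.rcol n s c' k) = P.cells n s c' := by
  rw [cells, zipWith_ofFn _ _ _ TSym.free hlen, cells]
  congr 1; funext i
  simp only [setR, qcol, hcol, hq, hd, hh, Cell.mk.injEq, true_and]
  funext k'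
  by_cases hk : k' = k
  · subst hk; simp
  · rw [Function.update_of_ne hk]; simp [rcol, hr k' hk]

/-! ### The rightward operations on encoded configurations -/

section ROps

/-- The push bijection extends the push rule. [folklore] -/
theorem extends_pushPerm (b : Bool) : Extends (pushPerm b) (pushSpec₂ b) := fun _ _ hx => completeRule_apply _ hx

/-- The rotation bijection extends the rotation rule. [folklore] -/
theorem extends_rotPerm : Extends rotPerm rotSpec₃ := fun _ _ hx => completeRule_apply _ hx

/-- The pop bijection extends the pop rule. [folklore] -/
theorem extends_popPerm : Extends popPerm (popSpec (α := Bool)) := fun _ _ hx => completeRule_apply _ hx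

/-- The boundary register decodes as a resting push. [folklore] -/
theorem decPush_reg (c : P.Conf) : P.decPush (P.reg c) = some Push2.seek := rfl

/-- The boundary register decodes as a resting rotation. [folklore] -/
theorem decRot_reg (c : P.Conf) : P.decRot (P.reg c) = some Rot3.seek := rfl

/-- The boundary register decodes its parked qubits. [folklore] -/
theorem decPark_reg (c : P.Conf) : P.decPark (P.reg c) = some ⟨c.parked.take P.amax, by simp⟩ := rfl

/-- A stack column with room for one more symbol. [folklore] -/
theorem rcol_eq_of_lt (c : P.Conf) (k : Fin P.K) (h : (c.regs k).length < n + s) :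
    P.rcol n s c k = frees (s - 1) ++ seg ((c.regs k).reverse.map Base.sym) ++
      TSym.free :: frees (n + s - (c.regs k).length - 1) := by
  rw [rcol, show n + s - (c.regs k).length = (n + s - (c.regs k).length - 1) + 1 by omega]
  rfl

/-- **Rightward pass, `push k b`**: the stack register `k` receives `b`; the register rests. [cite: BernsteinVaziraniSICOMP1997, §4] -/
theorem scan_opRAt_push {e : P.PC} {k : Fin P.K} {b : Bool} (hi : P.instr e = some (QInstr.push k b)) (c : P.Conf)
    (hs : 1 ≤ s) (hr : ∀ k', (c.regs k').length ≤ n + s) (hroom : (c.regs k).length < n + s) :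
    scan (P.opRAt e) (P.reg c) (P.cells n s c) =
      (P.reg c, P.cells n s { c with regs := Function.update c.regs k (b :: c.regs k) }) := by
  have hop : ∀ x, P.opRAt e x = liftRule (pushPerm b) P.decPush P.encPush (P.getR k) (P.setR k) x := fun x => by
    simp [opRAt, hi]
  have hlift := scan_lift (pushPerm b) (P.opRAt e) (P.encPush (P.reg c)) (P.getR k) (P.setR k)
    (fun st cell => by rw [hop]; exact liftRule_enc (P.liftLaws_push_R k) (P.reg c) Push2.seek (P.decPush_reg c) st cell)
    Push2.seek (P.cells n s c)
  rw [show P.encPush (P.reg c) Push2.seek = P.reg c from rfl] at hlift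
  rw [hlift, P.map_getR_cells c k (hr k) hs, P.rcol_eq_of_lt c k hroom,
    scan_eq_of_pscan (extends_pushPerm b) (pscan_push₂ b (s - 1) _ _)]
  simp only
  refine Prod.ext rfl ?_
  have hcol : P.rcol n s { c with regs := Function.update c.regs k (b :: c.regs k) } k =
      frees (s - 1) ++ seg ((c.regs k).reverse.map Base.sym ++ [Base.sym b]) ++ frees (n + s - (c.regs k).length - 1) := by
    simp [rcol, List.map_reverse]
    omega
  rw [← hcol, P.zipWith_setR_cells c { c with regs := Function.update c.regs k (b :: c.regs k) } k rfl rfl rfl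
    (fun k' hk' => by simp [hk'])]
  rw [hcol]; simp; omega

/-- The qubit column with room for one more cell. [folklore] -/
theorem qcol_eq_of_lt (c : P.Conf) (h : c.dead + c.queue.length < n + s) :
    P.qcol n s c = frees (s - 1) ++ seg (qbody c.dead c.queue) ++
      TSym.free :: frees (n + s - c.dead - c.queue.length - 1) := by
  rw [qcol, show n + s - c.dead - c.queue.length = (n + s - c.dead - c.queue.length - 1) + 1 by omega]
  rfl

/-- **Rightward pass, `qpush b`**: a fresh qubit `|b⟩` joins the back of the queue. [cite: NishimuraOzawa2002, Lemma 5.1] -/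
theorem scan_opRAt_qpush {e : P.PC} {b : Bool} {j : ℕ} (hi : P.instr e = some (QInstr.qpush b j)) (c : P.Conf)
    (hs : 1 ≤ s) (hroom : c.dead + c.queue.length < n + s) :
    scan (P.opRAt e) (P.reg c) (P.cells n s c) = (P.reg c, P.cells n s { c with queue := c.queue ++ [b] }) := by
  have hop : ∀ x, P.opRAt e x = liftRule (pushPerm b) P.decPush P.encPush P.getQ P.setQ x := fun x => by
    simp [opRAt, hi]
  have hlift := scan_lift (pushPerm b) (P.opRAt e) (P.encPush (P.reg c)) P.getQ P.setQ
    (fun st cell => by rw [hop]; exact liftRule_enc P.liftLaws_push_Q (P.reg c) Push2.seek (P.decPush_reg c) st cell)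
    Push2.seek (P.cells n s c)
  rw [show P.encPush (P.reg c) Push2.seek = P.reg c from rfl] at hlift
  rw [hlift, P.map_getQ_cells c hroom.le hs, P.qcol_eq_of_lt c hroom,
    scan_eq_of_pscan (extends_pushPerm b) (pscan_push₂ b (s - 1) _ _)]
  refine Prod.ext rfl ?_
  have hcol : P.qcol n s { c with queue := c.queue ++ [b] } =
      frees (s - 1) ++ seg (qbody c.dead c.queue ++ [Base.sym b]) ++ frees (n + s - c.dead - c.queue.length - 1) := by
    simp [qcol, qbody, List.append_assoc]; omega
  show List.zipWith P.setQ (P.cells n s c) _ = _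
  rw [← hcol, P.zipWith_setQ_cells c { c with queue := c.queue ++ [b] } rfl rfl]
  rw [hcol]; simp [qbody]; omega

/-- **Rightward pass, `qrot`**: the front qubit goes to the back, leaving a dead cell. [cite: NishimuraOzawa2002, Lemma 5.1] -/
theorem scan_opRAt_qrot {e : P.PC} {j : ℕ} (hi : P.instr e = some (QInstr.qrot j)) (c : P.Conf) {a : Bool} {rest : List Bool}
    (hq : c.queue = a :: rest) (hs : 1 ≤ s) (hroom : c.dead + c.queue.length < n + s) :
    scan (P.opRAt e) (P.reg c) (P.cells n s c) =
      (P.reg c, P.cells n s { c with queue := rest ++ [a], dead := c.dead + 1 }) := by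
  have hop : ∀ x, P.opRAt e x = liftRule rotPerm P.decRot P.encRot P.getQ P.setQ x := fun x => by
    simp [opRAt, hi]
  have hlift := scan_lift rotPerm (P.opRAt e) (P.encRot (P.reg c)) P.getQ P.setQ
    (fun st cell => by rw [hop]; exact liftRule_enc P.liftLaws_rot (P.reg c) Rot3.seek (P.decRot_reg c) st cell)
    Rot3.seek (P.cells n s c)
  rw [show P.encRot (P.reg c) Rot3.seek = P.reg c from rfl] at hlift
  rw [hlift, P.map_getQ_cells c hroom.le hs, P.qcol_eq_of_lt c hroom,
    show qbody c.dead c.queue = qbody c.dead (a :: rest) by rw [hq]]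
  have hscan : scan rotPerm Rot3.seek (frees (s - 1) ++ seg (qbody c.dead (a :: rest)) ++
      TSym.free :: frees (n + s - c.dead - c.queue.length - 1)) =
      (Rot3.seek, frees (s - 1) ++ seg (qbody (c.dead + 1) (rest ++ [a])) ++ frees (n + s - c.dead - c.queue.length - 1)) := by
    rcases eq_or_ne rest [] with hrest | hrest
    · subst hrest; exact scan_eq_of_pscan extends_rotPerm (pscan_rot₃_singleton (s - 1) _ c.dead a)
    · exact scan_eq_of_pscan extends_rotPerm (pscan_rot₃_cons (s - 1) _ c.dead a rest hrest)
  rw [hscan]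
  refine Prod.ext rfl ?_
  have hql : c.queue.length = rest.length + 1 := by rw [hq]; rfl
  have hcol : P.qcol n s { c with queue := rest ++ [a], dead := c.dead + 1 } =
      frees (s - 1) ++ seg (qbody (c.dead + 1) (rest ++ [a])) ++ frees (n + s - c.dead - c.queue.length - 1) := by
    simp [qcol, hql]; omega
  show List.zipWith P.setQ (P.cells n s c) _ = _
  rw [← hcol, P.zipWith_setQ_cells c { c with queue := rest ++ [a], dead := c.dead + 1 } rfl rfl]
  rw [hcol]; simp [qbody, hql]; omega

/-- The unwrapped read bijection extends the read rule. [folklore] -/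
theorem extends_readPerm_val :
    Extends (fun x : List Bool × TSym Bool => if h : x.1.length ≤ P.amax then
      ((P.readPerm (⟨x.1, h⟩, x.2)).1.1, (P.readPerm (⟨x.1, h⟩, x.2)).2) else x) readSpec := by
  intro x y hx
  obtain ⟨l, t⟩ := x
  have h1 : l.length ≤ 1 := by
    rcases l with _ | ⟨a, _ | ⟨b, l⟩⟩ <;> rcases t with _ | ⟨_ | _ | _ | c, _ | _⟩ <;> simp [readSpec] at hx ⊢
  have h2 : y.1.length ≤ 1 := by
    rcases l with _ | ⟨a, _ | ⟨b, l⟩⟩ <;> rcases t with _ | ⟨_ | _ | _ | c, _ | _⟩ <;>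
      simp only [readSpec, reduceCtorEq, Option.some.injEq] at hx <;> subst hx <;> simp
  have hl : l.length ≤ P.amax := h1.trans P.amax_pos
  simp only [dif_pos hl]
  have hw : P.wrapB readSpec (⟨l, hl⟩, t) = some (⟨y.1, h2.trans P.amax_pos⟩, y.2) := P.wrapB_eq_some _ _ _ _ hx _
  rw [show P.readPerm (⟨l, hl⟩, t) = (⟨y.1, h2.trans P.amax_pos⟩, y.2) from completeRule_apply _ hw]

/-- Scans of a bounded-list bijection through its unwrapping. [folklore] -/
theorem scan_val (perm : BList P.amax × TSym Bool → BList P.amax × TSym Bool) (l : BList P.amax) (cs : List (TSym Bool)) :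
    scan (fun x : List Bool × TSym Bool => if h : x.1.length ≤ P.amax then
      ((perm (⟨x.1, h⟩, x.2)).1.1, (perm (⟨x.1, h⟩, x.2)).2) else x) l.1 cs =
      ((scan perm l cs).1.1, (scan perm l cs).2) := by
  have := scan_lift perm (fun x : List Bool × TSym Bool => if h : x.1.length ≤ P.amax then
      ((perm (⟨x.1, h⟩, x.2)).1.1, (perm (⟨x.1, h⟩, x.2)).2) else x) Subtype.val id (fun _ t => t)
    (fun φ c => by simp [dif_pos φ.2]) l cs
  rw [List.map_id] at this
  rw [this]
  congr 1
  have hlen : (scan perm l cs).2.length = cs.length := length_scan _ _ _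
  refine List.ext_getElem (by simp [hlen]) fun i h₁ h₂ => ?_
  simp [List.getElem_zipWith]

/-- **Rightward pass, `qread`**: the front qubit is parked, leaving a dead cell. [cite: NishimuraOzawa2002, Lemma 5.1] -/
theorem scan_opRAt_qread {e : P.PC} {j : ℕ} (hi : P.instr e = some (QInstr.qread j)) (c : P.Conf) {a : Bool} {rest : List Bool}
    (hq : c.queue = a :: rest) (hp : c.parked = []) (hs : 1 ≤ s) (hfit : c.dead + c.queue.length ≤ n + s) :
    scan (P.opRAt e) (P.reg c) (P.cells n s c) =
      (P.reg { c with parked := [a] }, P.cells n s { c with queue := rest, dead := c.dead + 1 }) := by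
  have hop : ∀ x, P.opRAt e x = liftRule P.readPerm P.decPark P.encPark P.getQ P.setQ x := fun x => by
    simp [opRAt, hi]
  have hl0 : (⟨c.parked.take P.amax, by simp⟩ : BList P.amax) = ⟨[], by simp⟩ := by simp [hp]
  have hlift := scan_lift P.readPerm (P.opRAt e) (P.encPark (P.reg c)) P.getQ P.setQ
    (fun st cell => by rw [hop]; exact liftRule_enc P.liftLaws_park (P.reg c) _ (P.decPark_reg c) st cell)
    ⟨[], by simp⟩ (P.cells n s c)
  rw [show P.encPark (P.reg c) ⟨[], by simp⟩ = P.reg c by simp [encPark, reg, hp]] at hlift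
  rw [hlift, P.map_getQ_cells c hfit hs, qcol, show qbody c.dead c.queue = qbody c.dead (a :: rest) by rw [hq]]
  have hpscan : pscan readSpec [] (frees (s - 1) ++ seg (qbody c.dead (a :: rest)) ++ frees (n + s - c.dead - c.queue.length)) =
      some ([a], frees (s - 1) ++ seg (qbody (c.dead + 1) rest) ++ frees (n + s - c.dead - c.queue.length)) := by
    rcases eq_or_ne rest [] with hrest | hrest
    · subst hrest; exact pscan_read_singleton (s - 1) _ c.dead a
    · exact pscan_read_cons (s - 1) _ c.dead a rest hrest
  have hscanv := scan_eq_of_pscan P.extends_readPerm_val hpscan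
  rw [show ([] : List Bool) = (⟨[], by simp⟩ : BList P.amax).1 from rfl, P.scan_val] at hscanv
  simp only [Prod.mk.injEq] at hscanv
  obtain ⟨h1, h2⟩ := hscanv
  refine Prod.ext ?_ ?_
  · show P.encPark (P.reg c) _ = _
    have : (scan P.readPerm ⟨[], by simp⟩ (frees (s - 1) ++ seg (qbody c.dead (a :: rest)) ++
        frees (n + s - c.dead - c.queue.length))).1 = ⟨[a], P.amax_pos⟩ := Subtype.ext h1
    rw [this]
    have ht : [a].take P.amax = [a] := List.take_of_length_le (by simpa using P.amax_pos)
    simp [encPark, reg, ht]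
  · show List.zipWith P.setQ (P.cells n s c) _ = _
    rw [h2]
    have hql : c.queue.length = rest.length + 1 := by rw [hq]; rfl
    have hcol : P.qcol n s { c with queue := rest, dead := c.dead + 1 } =
        frees (s - 1) ++ seg (qbody (c.dead + 1) rest) ++ frees (n + s - c.dead - c.queue.length) := by
      simp [qcol, hql]; omega
    rw [← hcol, P.zipWith_setQ_cells c { c with queue := rest, dead := c.dead + 1 } rfl rfl]
    rw [hcol]; simp [qbody, hql]; omega

/-- **Rightward pass, instructions without a rightward operation** (`pop`, `goto`, halted): nothing happens. [folklore] -/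
theorem scan_opRAt_id {e : P.PC} (hi : ∀ x, P.opRAt e x = x) (φ : P.Reg) (cs : List P.Cell) :
    scan (P.opRAt e) φ cs = (φ, cs) :=
  scan_of_fixed _ _ _ fun c _ => hi (φ, c)

/-- `pop` has no rightward operation. [folklore] -/
theorem opRAt_pop {e : P.PC} {k : Fin P.K} {j : Option Bool → ℕ} (hi : P.instr e = some (QInstr.pop k j)) (x : P.Reg × P.Cell) :
    P.opRAt e x = x := by simp [opRAt, hi]

/-- `goto` has no rightward operation. [folklore] -/
theorem opRAt_goto {e : P.PC} {j : ℕ} (hi : P.instr e = some (QInstr.goto j)) (x : P.Reg × P.Cell) :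
    P.opRAt e x = x := by simp [opRAt, hi]

/-- A halted machine has no rightward operation. [folklore] -/
theorem opRAt_none {e : P.PC} (hi : P.instr e = none) (x : P.Reg × P.Cell) : P.opRAt e x = x := by simp [opRAt, hi]

/-- The unwrapped gather bijection extends the gather rule (for arities within the parking bound). [folklore] -/
theorem extends_gathPerm_val {k : ℕ} (hk : k ≤ P.amax) :
    Extends (fun x : List Bool × TSym Bool => if h : x.1.length ≤ P.amax then
      ((P.gathPerm k (⟨x.1, h⟩, x.2)).1.1, (P.gathPerm k (⟨x.1, h⟩, x.2)).2) else x) (gathSpec k) := by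
  intro x y hx
  obtain ⟨l, t⟩ := x
  by_cases hl : l.length ≤ P.amax
  · simp only [dif_pos hl]
    have hy : y.1.length ≤ P.amax := by
      rcases t with _ | ⟨_ | _ | _ | a, h'⟩ <;> simp only [gathSpec, Option.some.injEq] at hx <;>
        first | (subst hx; exact hl) | skip
      · simp at hx
      · split_ifs at hx with hlt <;> cases hx <;> simp <;> omega
    have hw : P.wrapB (gathSpec k) (⟨l, hl⟩, t) = some (⟨y.1, hy⟩, y.2) := P.wrapB_eq_some _ _ _ _ hx _
    rw [show P.gathPerm k (⟨l, hl⟩, t) = (⟨y.1, hy⟩, y.2) from completeRule_apply _ hw]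
  · simp only [dif_neg hl]
    rcases t with _ | ⟨_ | _ | _ | a, h'⟩ <;> simp only [gathSpec, Option.some.injEq] at hx <;>
      first | exact hx | skip
    · simp at hx
    · rw [if_neg (by omega)] at hx; exact Option.some.inj hx

/-- The unwrapped return bijection extends the return rule (for arities within the parking bound). [folklore] -/
theorem extends_retPerm_val {k : ℕ} (hk : k ≤ P.amax) :
    Extends (fun x : List Bool × TSym Bool => if h : x.1.length ≤ P.amax then
      ((P.retPerm k (⟨x.1, h⟩, x.2)).1.1, (P.retPerm k (⟨x.1, h⟩, x.2)).2) else x) (retSpec k) := by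
  intro x y hx
  obtain ⟨l, t⟩ := x
  by_cases hl : l.length ≤ P.amax
  · simp only [dif_pos hl]
    have hy : y.1.length ≤ P.amax := by
      rcases t with _ | ⟨_ | _ | _ | a, h'⟩
      · simp only [retSpec, Option.some.injEq] at hx; subst hx; exact hl
      · cases l <;> simp only [retSpec, Option.some.injEq, reduceCtorEq] at hx; subst hx; exact hl
      · cases l <;> simp only [retSpec, Option.some.injEq, reduceCtorEq] at hx; subst hx; exact hl
      · simp only [retSpec] at hx
        split at hx
        · simp at hx
        · split_ifs at hx; cases hx; simp; omega
      · simp only [retSpec] at hx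
        split_ifs at hx; cases hx; exact hl
    have hw : P.wrapB (retSpec k) (⟨l, hl⟩, t) = some (⟨y.1, hy⟩, y.2) := P.wrapB_eq_some _ _ _ _ hx _
    rw [show P.retPerm k (⟨l, hl⟩, t) = (⟨y.1, hy⟩, y.2) from completeRule_apply _ hw]
  · simp only [dif_neg hl]
    have hne : l ≠ [] := by rintro rfl; simp at hl
    rcases t with _ | ⟨_ | _ | _ | a, h'⟩
    · simp only [retSpec, Option.some.injEq] at hx; exact hx
    · cases l <;> simp [retSpec] at hx hne
    · cases l <;> simp [retSpec] at hx hne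
    · simp only [retSpec] at hx
      split at hx
      · simp at hx
      · split_ifs at hx with hle
        · omega
    · simp only [retSpec] at hx
      split_ifs at hx with hle
      · omega

/-- The gathered qubit column: `k` holes behind the dead prefix, then the rest of the queue. [cite: NishimuraOzawa2002, Lemma 5.1] -/
def gcol (n s : ℕ) (c : P.Conf) (k : ℕ) : List (TSym Bool) :=
  frees (s - 1) ++ seg (List.replicate c.dead Base.dead ++ List.replicate k Base.hole ++ (c.queue.drop k).map Base.sym) ++
    frees (n + s - c.dead - c.queue.length)

/-- **Rightward pass, `qgate g`**: the front `arity g` qubits are parked, leaving holes. [cite: NishimuraOzawa2002, Lemma 5.1] -/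
theorem scan_opRAt_qgate {e : P.PC} {g : P.G.Op} {j : ℕ} (hi : P.instr e = some (QInstr.qgate g j)) (c : P.Conf)
    (hp : c.parked = []) (hq : c.queue ≠ []) (hk : P.G.arity g ≤ c.queue.length) (hs : 1 ≤ s)
    (hfit : c.dead + c.queue.length ≤ n + s) :
    scan (P.opRAt e) (P.reg c) (P.cells n s c) =
      (P.reg { c with parked := c.queue.take (P.G.arity g) }, List.zipWith P.setQ (P.cells n s c) (P.gcol n s c (P.G.arity g))) := by
  have hka : P.G.arity g ≤ P.amax := P.arity_le g
  have hop : ∀ x, P.opRAt e x = liftRule (P.gathPerm (P.G.arity g)) P.decPark P.encPark P.getQ P.setQ x := fun x => by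
    simp [opRAt, hi]
  have hlift := scan_lift (P.gathPerm (P.G.arity g)) (P.opRAt e) (P.encPark (P.reg c)) P.getQ P.setQ
    (fun st cell => by rw [hop]; exact liftRule_enc P.liftLaws_park (P.reg c) _ (P.decPark_reg c) st cell)
    ⟨[], by simp⟩ (P.cells n s c)
  rw [show P.encPark (P.reg c) ⟨[], by simp⟩ = P.reg c by simp [encPark, reg, hp]] at hlift
  rw [hlift, P.map_getQ_cells c hfit hs, qcol]
  have hscan : scan (fun x : List Bool × TSym Bool => if h : x.1.length ≤ P.amax then
      ((P.gathPerm (P.G.arity g) (⟨x.1, h⟩, x.2)).1.1, (P.gathPerm (P.G.arity g) (⟨x.1, h⟩, x.2)).2) else x) []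
      (frees (s - 1) ++ seg (qbody c.dead c.queue) ++ frees (n + s - c.dead - c.queue.length)) =
      (c.queue.take (P.G.arity g), frees (s - 1) ++
        seg (List.replicate c.dead Base.dead ++ List.replicate (P.G.arity g) Base.hole ++ (c.queue.drop (P.G.arity g)).map Base.sym) ++
        frees (n + s - c.dead - c.queue.length)) := by
    rcases hk.lt_or_eq with hlt | heq
    · exact scan_gath_lt (P.extends_gathPerm_val hka) (s - 1) _ c.dead c.queue hlt
    · rw [scan_gath_all (P.extends_gathPerm_val hka) (s - 1) _ c.dead c.queue heq hq, heq,
        List.take_length, List.drop_length]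
  rw [show ([] : List Bool) = (⟨[], by simp⟩ : BList P.amax).1 from rfl, P.scan_val] at hscan
  simp only [Prod.mk.injEq] at hscan
  obtain ⟨h1, h2⟩ := hscan
  refine Prod.ext ?_ ?_
  · show P.encPark (P.reg c) _ = _
    have : (scan (P.gathPerm (P.G.arity g)) ⟨[], by simp⟩
        (frees (s - 1) ++ seg (qbody c.dead c.queue) ++ frees (n + s - c.dead - c.queue.length))).1 =
        ⟨c.queue.take (P.G.arity g), by simp; omega⟩ := Subtype.ext h1
    rw [this]
    have ht : (c.queue.take (P.G.arity g)).take P.amax = c.queue.take (P.G.arity g) :=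
      List.take_of_length_le (by simp; omega)
    simp [encPark, reg, ht]
  · show List.zipWith P.setQ (P.cells n s c) _ = _
    rw [h2]; rfl

end ROps

/-! ### Growing the geometry by one sweep -/

/-- `getD` into `x :: l ++ [y]`. [folklore] -/
theorem getD_cons_append_singleton {β : Type} (x y d : β) (l : List β) (i : ℕ) (hi : i < l.length + 2) :
    (x :: (l ++ [y])).getD i d = if i = 0 then x else if i = l.length + 1 then y else l.getD (i - 1) d := by
  rcases i with _ | i
  · simp
  · simp only [List.getD_cons_succ, Nat.succ_ne_zero, if_false, Nat.add_right_cancel_iff]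
    by_cases h : i = l.length
    · subst h; simp [List.getD_eq_getElem?_getD]
    · rw [if_neg h]
      have hi' : i < l.length := by omega
      simp [List.getD_eq_getElem?_getD, List.getElem?_append_left hi']

/-- A run of free cells, last one split off. [folklore] -/
theorem frees_succ' {α : Type} (k : ℕ) : (frees (k + 1) : List (TSym α)) = frees k ++ [TSym.free] :=
  List.replicate_succ'

/-- The cells, entrywise. [folklore] -/
theorem getElem_cells (c : P.Conf) (i : ℕ) (hi : i < (P.cells n s c).length) :
    (P.cells n s c)[i] = ⟨(tagcol n s).getD i false, (P.qcol n s c).getD i TSym.free, (P.hcol n s c).getD i TSym.free,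
      fun k => (P.rcol n s c k).getD i TSym.free⟩ := by
  simp [cells]

/-- The number of cells. [folklore] -/
@[simp] theorem length_cells (c : P.Conf) : (P.cells n s c).length = n + 2 * s := by simp [cells]

/-- **The cells at the next boundary** are the cells at this boundary between two pads (for a
configuration fitting this boundary's region). [folklore] -/
theorem cells_succ (c : P.Conf) (hs : 1 ≤ s) (hq : c.dead + c.queue.length ≤ n + s) (hh : c.hist.length ≤ n + s)
    (hr : ∀ k, (c.regs k).length ≤ n + s) :
    P.cells n (s + 1) c = P.pad :: (P.cells n s c ++ [P.pad]) := by
  have hs1 : s + 1 - 1 = (s - 1) + 1 := by omega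
  have hqc : P.qcol n (s + 1) c = TSym.free :: (P.qcol n s c ++ [TSym.free]) := by
    rw [qcol, qcol, hs1, show n + (s + 1) - c.dead - c.queue.length = (n + s - c.dead - c.queue.length) + 1 by omega]
    show TSym.free :: (frees (s - 1) ++ seg (qbody c.dead c.queue) ++ frees (n + s - c.dead - c.queue.length + 1)) = _
    rw [frees_succ']; simp [List.append_assoc]
  have hhc : P.hcol n (s + 1) c = TSym.free :: (P.hcol n s c ++ [TSym.free]) := by
    rw [hcol, hcol, hs1, show n + (s + 1) - c.hist.length = (n + s - c.hist.length) + 1 by omega]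
    show TSym.free :: (frees (s - 1) ++ seg (c.hist.map Base.sym) ++ frees (n + s - c.hist.length + 1)) = _
    rw [frees_succ']; simp [List.append_assoc]
  have hrc : ∀ k, P.rcol n (s + 1) c k = TSym.free :: (P.rcol n s c k ++ [TSym.free]) := by
    intro k
    rw [rcol, rcol, hs1, show n + (s + 1) - (c.regs k).length = (n + s - (c.regs k).length) + 1 by have := hr k; omega]
    show TSym.free :: (frees (s - 1) ++ seg ((c.regs k).reverse.map Base.sym) ++ frees (n + s - (c.regs k).length + 1)) = _
    rw [frees_succ']; simp [List.append_assoc]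
  have htc : tagcol n (s + 1) = false :: (tagcol n s ++ [false]) := by
    rw [tagcol, tagcol, hs1, show n + (s + 1) = (n + s) + 1 by omega]
    show false :: (List.replicate (n + s) false ++ [true] ++ List.replicate (s - 1 + 1) false) = _
    rw [List.replicate_succ']; simp [List.append_assoc]
  have hlq := P.length_qcol c hq hs
  have hlh := P.length_hcol c hh hs
  have hlr := fun k => P.length_rcol c k (hr k) hs
  have hlt : (tagcol n s).length = n + 2 * s := length_tagcol hs
  have hlen : (P.cells n s c).length = n + 2 * s := P.length_cells c
  refine List.ext_getElem (by simp; ring) fun i h₁ h₂ => ?_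
  rw [P.getElem_cells c i h₁, hqc, hhc, htc]
  simp only [hrc]
  rcases i with _ | j
  · rw [List.getElem_cons_zero]
    simp [pad]
  · rw [List.getElem_cons_succ]
    simp only [List.getD_cons_succ]
    by_cases hj : j < n + 2 * s
    · rw [List.getElem_append_left (by rw [hlen]; exact hj), P.getElem_cells c j (by rw [hlen]; exact hj),
        List.getD_append _ _ _ _ (by rw [hlt]; exact hj), List.getD_append _ _ _ _ (by rw [hlq]; exact hj),
        List.getD_append _ _ _ _ (by rw [hlh]; exact hj)]
      simp only [Cell.mk.injEq, true_and]
      funext k; rw [List.getD_append _ _ _ _ (by rw [hlr]; exact hj)]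
    · have hj' : j = n + 2 * s := by simp at h₂; omega
      subst hj'
      rw [List.getElem_append_right (by rw [hlen]), List.getD_append_right _ _ _ _ (by rw [hlt]),
        List.getD_append_right _ _ _ _ (by rw [hlq]), List.getD_append_right _ _ _ _ (by rw [hlh])]
      simp only [hlen, hlt, hlq, hlh, Nat.sub_self, List.getElem_singleton, List.getD_cons_zero, pad, Cell.mk.injEq,
        true_and]
      funext k; rw [List.getD_append_right _ _ _ _ (by rw [hlr])]; simp [hlr]

/-! ### The rightward pass from a boundary, the turn -/

/-- The history column with room for the record of this sweep. [folklore] -/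
theorem hcol_eq_of_lt (c : P.Conf) (h : c.hist.length < n + s) :
    P.hcol n s c = frees (s - 1) ++ seg (c.hist.map Base.sym) ++ TSym.free :: frees (n + s - c.hist.length - 1) := by
  rw [hcol, show n + s - c.hist.length = (n + s - c.hist.length - 1) + 1 by omega]
  rfl

/-- **The rightward pass from a boundary**: the history push commits the pending record (history
column of `commit c`, register `(false, next, none)`), the operation of the next instruction acts
on its track. [cite: BernsteinVaziraniSICOMP1997, §4] -/
theorem scan_ruleR_enc (c : P.Conf) (hh : c.hist.length < n + s) {ψ' : P.Reg} {cs' : List P.Cell}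
    (hop : scan (P.opRAt (P.next (c.cur, c.res))) (P.reg c) (P.cells n s c) = (ψ', cs')) (hs : 1 ≤ s) :
    scan P.spec.ruleR (P.reg c) (P.cells n s c) =
      (P.encH ψ' (false, P.next (c.cur, c.res), none), List.zipWith P.setH cs' (P.hcol n s (P.commit c))) := by
  have h := P.scan_ruleR_run (P.next (c.cur, c.res)) (P.cells n s c) (P.reg c) (false, c.cur, some (c.cur, c.res))
    (false, P.next (c.cur, c.res), none) (P.hcol n s (P.commit c)) rfl rfl ?_
  · rw [show P.encH (P.reg c) (false, c.cur, some (c.cur, c.res)) = P.reg c from rfl, hop] at h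
    exact h
  · rw [P.map_getH_cells c hh.le hs, P.hcol_eq_of_lt c hh, P.pscan_h (s - 1) _ c.hist c.cur (c.cur, c.res) rfl]
    congr 2
    simp [hcol, commit, List.map_append]; omega

/-- The next instruction is never the reserved address `0`. [folklore] -/
theorem next_ne_zero (r : P.Rec) : (P.next r).1 ≠ 0 := by
  have hL := P.one_le_L
  unfold next
  have hc : ∀ j, (P.clamp j).1 ≠ 0 := fun j => by have := P.clamp_pos j; omega
  split
  · -- halted: `r.1 = L`
    rename_i h
    have h1 : ¬ r.1.1 < P.code.length := fun hlt => by simp [instr, List.getElem?_eq_getElem hlt] at h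
    have hL' : 1 ≤ P.code.length := hL
    show r.1.1 ≠ 0
    omega
  all_goals first | exact hc _ | (split <;> exact hc _)

/-- The register after the rightward pass of a sweep executing `cur'` with parked qubits `pk`. [folklore] -/
def postR (cur' : P.PC) (pk : List Bool) : P.Reg := ⟨false, cur', none, false, Micro.idle, ⟨pk.take P.amax, by simp⟩⟩

/-- The armed register (pending record `(cur', notpop)`). [folklore] -/
def armed (cur' : P.PC) (pk : List Bool) : P.Reg :=
  ⟨false, cur', some (cur', PopRes.notpop), false, Micro.idle, ⟨pk.take P.amax, by simp⟩⟩

/-- `encH` of a boundary-type register. [folklore] -/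
theorem encH_reg (c : P.Conf) (cur' : P.PC) : P.encH (P.reg c) (false, cur', none) = P.postR cur' c.parked := rfl

/-- **The classical part of the turn arms the record** of the instruction being executed. [cite: BernsteinVaziraniSICOMP1997, §4] -/
theorem turnσ_postR (r : P.Rec) (pk : List Bool) : P.turnσ (P.postR (P.next r) pk) = P.armed (P.next r) pk := by
  rw [P.turnσ_of_last_none _ rfl rfl]
  · rfl
  · intro h
    have := congrArg (fun φ : P.Reg => φ.cur.1) h
    exact P.next_ne_zero r (by simpa [postR, reg₁'] using this)

/-- The armed register is the boundary register of the committed configuration with `notpop`. [folklore] -/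
theorem armed_eq_reg (c : P.Conf) (pk : List Bool) :
    P.armed (P.next (c.cur, c.res)) pk = P.reg { P.commit c with res := PopRes.notpop, parked := pk } := rfl

/-- **The gate amplitude outside gate instructions is the identity.** [folklore] -/
theorem gateAmp_armed_of_not_gate (cur' : P.PC) (pk : List Bool) (h : ∀ g j, P.instr cur' ≠ some (QInstr.qgate g j)) (ψ : P.Reg) :
    P.gateAmp (P.armed cur' pk) ψ = if P.armed cur' pk = ψ then 1 else 0 := by
  refine P.gateAmp_of_not_inGate (fun g hg => ?_) ψ
  exfalso
  unfold gateOf at hg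
  split at hg
  · rename_i g' j' heq; cases hg; exact h g j' heq
  · simp at hg

/-! ### The leftward pass -/

/-- On registers executing an instruction other than `pop`/`qgate`, the leftward rule is the identity. [folklore] -/
theorem ruleLFun_id {φ : P.Reg} (hini : φ.ini = false)
    (hp : ∀ k j, P.instr φ.cur ≠ some (QInstr.pop k j)) (hg : ∀ g j, P.instr φ.cur ≠ some (QInstr.qgate g j))
    (c : P.Cell) : P.ruleLFun (φ, c) = (φ, c) := by
  unfold ruleLFun
  rw [if_neg (by simp [hini])]
  split
  · rename_i k j h; exact absurd h (hp k j)
  · rename_i g j h; exact absurd h (hg g j)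
  · rfl

/-- **Leftward pass, no leftward operation**: nothing happens. [folklore] -/
theorem scan_ruleL_id {φ : P.Reg} (hini : φ.ini = false)
    (hp : ∀ k j, P.instr φ.cur ≠ some (QInstr.pop k j)) (hg : ∀ g j, P.instr φ.cur ≠ some (QInstr.qgate g j))
    (cs : List P.Cell) : scan P.spec.ruleL φ cs = (φ, cs) :=
  scan_of_fixed _ _ _ fun c _ => P.ruleLFun_id hini hp hg c

/-- Reversing a `zipWith` of lists of equal lengths. [folklore] -/
theorem reverse_zipWith {α β γ : Type} (f : α → β → γ) (l : List α) (l' : List β) (h : l.length = l'.length) :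
    (List.zipWith f l l').reverse = List.zipWith f l.reverse l'.reverse := by
  induction l generalizing l' with
  | nil => simp
  | cons a l ih =>
    cases l' with
    | nil => simp at h
    | cons b l' =>
      simp only [List.length_cons, Nat.add_right_cancel_iff] at h
      rw [List.zipWith_cons_cons, List.reverse_cons, List.reverse_cons, List.reverse_cons, ih l' h,
        List.zipWith_append (by simp [h])]
      rfl

/-- On registers executing `pop k j`, the leftward rule is the lifted pop. [folklore] -/
theorem ruleLFun_pop {φ : P.Reg} (hini : φ.ini = false) {k : Fin P.K} {j : Option Bool → ℕ}
    (hi : P.instr φ.cur = some (QInstr.pop k j)) (c : P.Cell) :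
    P.ruleLFun (φ, c) = liftRule popPerm P.decPop P.encPop (P.getR k) (P.setR k) (φ, c) := by
  unfold ruleLFun
  rw [if_neg (by simp [hini])]
  simp only [hi]

/-- The armed register decodes as a resting pop of the current instruction. [folklore] -/
theorem decPop_armed (cur' : P.PC) (pk : List Bool) : P.decPop (P.armed cur' pk) = some PopSt.seek := by
  simp [decPop, armed]

/-- A stack column followed by one more free cell. [folklore] -/
theorem rcol_append_free (c : P.Conf) (k : Fin P.K) :
    P.rcol n s c k ++ [TSym.free] = frees (s - 1) ++ seg ((c.regs k).reverse.map Base.sym) ++ frees (n + s - (c.regs k).length + 1) := by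
  rw [rcol, frees_succ', List.append_assoc]

/-- **Leftward pass, `pop k`**: the top of register `k` (if any) goes into the pending record. [cite: BernsteinVaziraniSICOMP1997, §4] -/
theorem scan_ruleL_pop {cur' : P.PC} {k : Fin P.K} {j : Option Bool → ℕ} (hi : P.instr cur' = some (QInstr.pop k j))
    (c : P.Conf) (pk : List Bool) (hs : 1 ≤ s) (hr : ∀ k', (c.regs k').length ≤ n + s) :
    scan P.spec.ruleL (P.armed cur' pk) (P.pad :: (P.cells n s c).reverse) =
      (⟨false, cur', some (cur', PopRes.popped (c.regs k).head?), false, Micro.idle, ⟨pk.take P.amax, by simp⟩⟩,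
        P.pad :: (P.cells n s { c with regs := Function.update c.regs k (c.regs k).tail }).reverse) := by
  have hlift := scan_lift popPerm P.spec.ruleL (P.encPop (P.armed cur' pk)) (P.getR k) (P.setR k)
    (fun st cell => by
      show P.ruleLFun _ = _
      rw [P.ruleLFun_pop (φ := P.encPop (P.armed cur' pk) st) (by cases st <;> rfl) (k := k) (j := j)
        (by cases st <;> exact hi)]
      exact liftRule_enc (P.liftLaws_pop k) (P.armed cur' pk) PopSt.seek (P.decPop_armed cur' pk) st cell)
    PopSt.seek (P.pad :: (P.cells n s c).reverse)
  rw [show P.encPop (P.armed cur' pk) PopSt.seek = P.armed cur' pk from rfl] at hlift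
  rw [hlift, List.map_cons, List.map_reverse, P.map_getR_cells c k (hr k) hs,
    show P.getR k P.pad = TSym.free from rfl, ← List.reverse_concat', P.rcol_append_free c k]
  -- the pop on the reversed column
  have hlen : (P.cells n s c).length = (P.rcol n s c k).length := by rw [P.length_cells, P.length_rcol c k (hr k) hs]
  rcases hq : c.regs k with _ | ⟨a, tl⟩
  · -- empty register: nothing changes
    rw [show ([] : List Bool).reverse.map Base.sym = [] from rfl, scan_pop_nil extends_popPerm (s - 1) _]
    simp only [List.tail_nil, List.head?_nil]
    have hcc : ({ c with regs := Function.update c.regs k [] } : P.Conf) = c := by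
      obtain ⟨c1, c2, c3, c4, c5, c6, c7⟩ := c
      simp only at hq ⊢
      rw [← hq, Function.update_eq_self]
    rw [hcc]
    refine Prod.ext rfl ?_
    show List.zipWith (P.setR k) (P.pad :: (P.cells n s c).reverse) _ = _
    rw [show frees (s - 1) ++ seg ([] : List (Base Bool)) ++ frees (n + s - ([] : List Bool).length + 1) =
        P.rcol n s c k ++ [TSym.free] by rw [P.rcol_append_free c k, hq]; rfl,
      List.reverse_concat', List.zipWith_cons_cons, ← reverse_zipWith _ _ _ hlen,
      show P.setR k P.pad TSym.free = P.pad by simp [setR, pad],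
      P.zipWith_setR_cells c c k rfl rfl rfl (fun _ _ => rfl) (P.length_rcol c k (hr k) hs)]
  · -- a data symbol on top
    rw [show (a :: tl).reverse.map Base.sym = tl.reverse.map Base.sym ++ [Base.sym a] by simp,
      scan_pop_sym extends_popPerm (s - 1) _ _ a]
    simp only [List.tail_cons, List.head?_cons]
    refine Prod.ext rfl ?_
    show List.zipWith (P.setR k) (P.pad :: (P.cells n s c).reverse) _ = _
    have h2 : tl.length + 1 ≤ n + s := by have := hr k; rw [hq] at this; simpa using this
    have htl : tl.length ≤ n + s := by omega
    have hq' : ({ c with regs := Function.update c.regs k tl } : P.Conf).regs k = tl := by simp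
    have hcol : frees (s - 1) ++ seg (tl.reverse.map Base.sym) ++ frees (n + s - (a :: tl).length + 1 + 1) =
        P.rcol n s { c with regs := Function.update c.regs k tl } k ++ [TSym.free] := by
      rw [P.rcol_append_free, hq', show n + s - (a :: tl).length + 1 + 1 = n + s - tl.length + 1 by simp; omega]
    have hlen' : (P.cells n s c).length = (P.rcol n s { c with regs := Function.update c.regs k tl } k).length := by
      rw [P.length_cells, P.length_rcol _ k (by rw [hq']; exact htl) hs]
    rw [hcol, List.reverse_concat', List.zipWith_cons_cons, ← reverse_zipWith _ _ _ hlen',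
      show P.setR k P.pad TSym.free = P.pad by simp [setR, pad],
      P.zipWith_setR_cells c { c with regs := Function.update c.regs k tl } k rfl rfl rfl (fun k' hk' => by simp [hk'])
        (P.length_rcol _ k (by rw [hq']; exact htl) hs)]

/-! ### One sweep on an encoded configuration: deterministic instructions -/

/-- **One sweep, deterministic instruction** (generic form): the rightward pass (history push and
the operation, `hop`), the turn (arming; the gate amplitude is the identity, `hng`) and the
leftward pass (`hL`) compose to ONE boundary configuration with the same amplitude. [cite: NishimuraOzawa2002, Lemma 5.1] -/
theorem dynStep_single_of_det (c : P.Conf) (hs : 1 ≤ s) (hh : c.hist.length < n + s)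
    {pk : List Bool} {csR : List P.Cell}
    (hop : scan (P.opRAt (P.next (c.cur, c.res))) (P.reg c) (P.cells n s c) = (P.reg { c with parked := pk }, csR))
    (hng : ∀ g j, P.instr (P.next (c.cur, c.res)) ≠ some (QInstr.qgate g j))
    {φL : P.Reg} {csL : List P.Cell}
    (hL : scan P.spec.ruleL (P.armed (P.next (c.cur, c.res)) pk)
      (P.pad :: (List.zipWith P.setH csR (P.hcol n s (P.commit c))).reverse) = (φL, csL))
    (a : ℂ) :
    P.spec.dynStep P.pad P.pad (Finsupp.single (P.enc n s c) a) = Finsupp.single (φL, P.pad :: csL.reverse) a := by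
  classical
  have hR : scan P.spec.ruleR (P.reg c) (P.cells n s c) =
      (P.postR (P.next (c.cur, c.res)) pk, List.zipWith P.setH csR (P.hcol n s (P.commit c))) := by
    rw [P.scan_ruleR_enc c hh hop hs]; rfl
  have hturn : ∀ ψ, P.spec.turnAmp (P.reg c) (P.cells n s c) ψ = if P.armed (P.next (c.cur, c.res)) pk = ψ then 1 else 0 := by
    intro ψ
    show P.turn (scan P.spec.ruleR (P.reg c) (P.cells n s c)).1 ψ = _
    rw [hR]
    show P.gateAmp (P.turnσ (P.postR (P.next (c.cur, c.res)) pk)) ψ = _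
    rw [P.turnσ_postR, P.gateAmp_armed_of_not_gate _ _ hng]
  unfold SweepSpec.dynStep
  rw [Finsupp.sum_single_index (by simp)]
  simp only [enc]
  simp_rw [hturn]
  rw [Finset.sum_eq_single (P.armed (P.next (c.cur, c.res)) pk) (fun ψ _ hψ => by rw [if_neg (Ne.symm hψ), mul_zero, Finsupp.single_zero])
    (fun h => absurd (Finset.mem_univ _) h)]
  rw [if_pos rfl, mul_one]
  congr 1
  show ((scan P.spec.ruleL (P.armed (P.next (c.cur, c.res)) pk)
      (P.pad :: (scan P.spec.ruleR (P.reg c) (P.cells n s c)).2.reverse)).1,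
    P.pad :: ((scan P.spec.ruleL (P.armed (P.next (c.cur, c.res)) pk)
      (P.pad :: (scan P.spec.ruleR (P.reg c) (P.cells n s c)).2.reverse)).2).reverse) = _
  rw [hR]
  simp only
  rw [hL]

/-- **Room and shape conditions** for the instruction executed in this sweep (the program and the
input guarantee them; they are what the track operations need). [folklore] -/
structure StepOK (n s : ℕ) (c : P.Conf) : Prop where
  fits : P.Fits n s c
  push_room : ∀ k b, P.instr (P.next (c.cur, c.res)) = some (QInstr.push k b) → (c.regs k).length < n + s
  qpush_room : ∀ b j, P.instr (P.next (c.cur, c.res)) = some (QInstr.qpush b j) → c.dead + c.queue.length < n + s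
  qrot_ok : ∀ j, P.instr (P.next (c.cur, c.res)) = some (QInstr.qrot j) → c.queue ≠ [] ∧ c.dead + c.queue.length < n + s
  qgate_ok : ∀ g j, P.instr (P.next (c.cur, c.res)) = some (QInstr.qgate g j) →
    c.parked = [] ∧ c.queue ≠ [] ∧ P.G.arity g ≤ c.queue.length
  qread_ok : ∀ j, P.instr (P.next (c.cur, c.res)) = some (QInstr.qread j) → c.queue ≠ [] ∧ c.parked = []

/-- The history of a committed configuration. [folklore] -/
theorem commit_hist (c : P.Conf) : (P.commit c).hist = c.hist ++ [(c.cur, c.res)] := rfl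

/-- The encoding at the next boundary of a configuration fitting this boundary: its register and
its cells between two pads. [folklore] -/
theorem enc_succ (c : P.Conf) (hs : 1 ≤ s) (hq : c.dead + c.queue.length ≤ n + s) (hh : c.hist.length ≤ n + s)
    (hr : ∀ k, (c.regs k).length ≤ n + s) :
    P.enc n (s + 1) c = (P.reg c, P.pad :: (P.pad :: (P.cells n s c).reverse).reverse) := by
  rw [enc, P.cells_succ c hs hq hh hr]; simp

/-- The parked qubits of a committed configuration. [folklore] -/
theorem reg_commit_res (c : P.Conf) (res : PopRes) :
    P.reg { P.commit c with res := res } =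
      ⟨false, P.next (c.cur, c.res), some (P.next (c.cur, c.res), res), false, Micro.idle, ⟨c.parked.take P.amax, by simp⟩⟩ := rfl

/-- **One sweep, `push k b`.** [cite: BernsteinVaziraniSICOMP1997, §4] -/
theorem dynStep_enc_push (c : P.Conf) (hok : P.StepOK n s c) {k : Fin P.K} {b : Bool}
    (hi : P.instr (P.next (c.cur, c.res)) = some (QInstr.push k b)) (a : ℂ) :
    P.spec.dynStep P.pad P.pad (Finsupp.single (P.enc n s c) a) =
      (P.stepConf c).sum fun c' m => Finsupp.single (P.enc n (s + 1) c') (a * m) := by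
  have hs := hok.fits.one_le
  have hh : c.hist.length < n + s := by rw [hok.fits.hist_eq]; omega
  have hroom := hok.push_room k b hi
  set cX : P.Conf := { c with regs := Function.update c.regs k (b :: c.regs k) } with hcX
  set cH : P.Conf := { cX with hist := c.hist ++ [(c.cur, c.res)] } with hcH
  have hrX : ∀ k', (cX.regs k').length ≤ n + s := fun k' => by
    by_cases hk : k' = k
    · subst hk; simp [hcX]; omega
    · simp [hcX, hk, hok.fits.regs_le k']
  have hop := P.scan_opRAt_push (s := s) (n := n) hi c hs hok.fits.regs_le hroom
  have hsetH : List.zipWith P.setH (P.cells n s cX) (P.hcol n s (P.commit c)) = P.cells n s cH := by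
    rw [show P.hcol n s (P.commit c) = P.hcol n s cH by simp [hcol, commit, hcH]]
    exact P.zipWith_setH_cells cX cH rfl rfl rfl (P.length_hcol cH (by simp [hcH, hcX]; omega) hs)
  rw [P.dynStep_single_of_det c hs hh (pk := c.parked) (csR := P.cells n s cX) (by rw [hop])
    (fun g j h => by rw [hi] at h; cases h)
    (φL := P.armed (P.next (c.cur, c.res)) c.parked) (csL := P.pad :: (P.cells n s cH).reverse)
    (by rw [hsetH]; exact P.scan_ruleL_id rfl (fun k' j h => by simp [armed, hi] at h) (fun g j h => by simp [armed, hi] at h) _) a]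
  -- the abstract step
  have hstep : P.stepConf c = Finsupp.single { P.commit c with res := PopRes.notpop, regs := Function.update c.regs k (b :: c.regs k) } 1 := by
    simp [stepConf, hi, commit]
  rw [hstep, Finsupp.sum_single_index (by simp), mul_one,
    P.enc_succ _ (by simpa using hs) (by simpa [commit] using hok.fits.queue_le) (by simp [commit, hok.fits.hist_eq]; omega)
      (fun k' => by simpa [commit] using hrX k')]
  congr 1

/-- **One sweep, an instruction with neither a rightward nor a leftward operation** (`goto`, halted). [cite: NishimuraOzawa2002, Lemma 5.1] -/
theorem dynStep_enc_noop (c : P.Conf) (hok : P.StepOK n s c)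
    (hR : ∀ x, P.opRAt (P.next (c.cur, c.res)) x = x)
    (hp : ∀ k j, P.instr (P.next (c.cur, c.res)) ≠ some (QInstr.pop k j))
    (hg : ∀ g j, P.instr (P.next (c.cur, c.res)) ≠ some (QInstr.qgate g j))
    (hstep : P.stepConf c = Finsupp.single { P.commit c with res := PopRes.notpop } 1) (a : ℂ) :
    P.spec.dynStep P.pad P.pad (Finsupp.single (P.enc n s c) a) =
      (P.stepConf c).sum fun c' m => Finsupp.single (P.enc n (s + 1) c') (a * m) := by
  have hs := hok.fits.one_le
  have hh : c.hist.length < n + s := by rw [hok.fits.hist_eq]; omega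
  set cH : P.Conf := { c with hist := c.hist ++ [(c.cur, c.res)] } with hcH
  have hsetH : List.zipWith P.setH (P.cells n s c) (P.hcol n s (P.commit c)) = P.cells n s cH := by
    rw [show P.hcol n s (P.commit c) = P.hcol n s cH by simp [hcol, commit, hcH]]
    exact P.zipWith_setH_cells c cH rfl rfl rfl (P.length_hcol cH (by simp [hcH]; omega) hs)
  rw [P.dynStep_single_of_det c hs hh (pk := c.parked) (csR := P.cells n s c) (P.scan_opRAt_id hR _ _) hg
    (φL := P.armed (P.next (c.cur, c.res)) c.parked) (csL := P.pad :: (P.cells n s cH).reverse)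
    (by rw [hsetH]; exact P.scan_ruleL_id rfl (by simpa [armed] using hp) (by simpa [armed] using hg) _) a]
  rw [hstep, Finsupp.sum_single_index (by simp), mul_one,
    P.enc_succ _ (by simpa using hs) (by simpa [commit] using hok.fits.queue_le) (by simp [commit, hok.fits.hist_eq]; omega)
      (fun k' => by simpa [commit] using hok.fits.regs_le k')]
  congr 1

/-- **One sweep, `goto`.** [cite: NishimuraOzawa2002, Lemma 5.1] -/
theorem dynStep_enc_goto (c : P.Conf) (hok : P.StepOK n s c) {j : ℕ} (hi : P.instr (P.next (c.cur, c.res)) = some (QInstr.goto j)) (a : ℂ) :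
    P.spec.dynStep P.pad P.pad (Finsupp.single (P.enc n s c) a) =
      (P.stepConf c).sum fun c' m => Finsupp.single (P.enc n (s + 1) c') (a * m) :=
  P.dynStep_enc_noop c hok (P.opRAt_goto hi) (fun k j h => by rw [hi] at h; cases h) (fun g j h => by rw [hi] at h; cases h)
    (by simp [stepConf, commit, hi]) a

/-- **One sweep, halted** (the machine idles, its history keeps growing). [cite: NishimuraOzawa2002, Lemma 5.1] -/
theorem dynStep_enc_halt (c : P.Conf) (hok : P.StepOK n s c) (hi : P.instr (P.next (c.cur, c.res)) = none) (a : ℂ) :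
    P.spec.dynStep P.pad P.pad (Finsupp.single (P.enc n s c) a) =
      (P.stepConf c).sum fun c' m => Finsupp.single (P.enc n (s + 1) c') (a * m) :=
  P.dynStep_enc_noop c hok (P.opRAt_none hi) (fun k j h => by rw [hi] at h; cases h) (fun g j h => by rw [hi] at h; cases h)
    (by simp [stepConf, commit, hi]) a

/-- **One sweep, `qpush b`.** [cite: NishimuraOzawa2002, Lemma 5.1] -/
theorem dynStep_enc_qpush (c : P.Conf) (hok : P.StepOK n s c) {b : Bool} {j : ℕ}
    (hi : P.instr (P.next (c.cur, c.res)) = some (QInstr.qpush b j)) (a : ℂ) :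
    P.spec.dynStep P.pad P.pad (Finsupp.single (P.enc n s c) a) =
      (P.stepConf c).sum fun c' m => Finsupp.single (P.enc n (s + 1) c') (a * m) := by
  have hs := hok.fits.one_le
  have hh : c.hist.length < n + s := by rw [hok.fits.hist_eq]; omega
  have hroom := hok.qpush_room b j hi
  set cX : P.Conf := { c with queue := c.queue ++ [b] } with hcX
  set cH : P.Conf := { cX with hist := c.hist ++ [(c.cur, c.res)] } with hcH
  have hop := P.scan_opRAt_qpush (s := s) (n := n) hi c hs hroom
  have hsetH : List.zipWith P.setH (P.cells n s cX) (P.hcol n s (P.commit c)) = P.cells n s cH := by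
    rw [show P.hcol n s (P.commit c) = P.hcol n s cH by simp [hcol, commit, hcH]]
    exact P.zipWith_setH_cells cX cH rfl rfl rfl (P.length_hcol cH (by simp [hcH, hcX]; omega) hs)
  rw [P.dynStep_single_of_det c hs hh (pk := c.parked) (csR := P.cells n s cX) (by rw [hop])
    (fun g j h => by rw [hi] at h; cases h)
    (φL := P.armed (P.next (c.cur, c.res)) c.parked) (csL := P.pad :: (P.cells n s cH).reverse)
    (by rw [hsetH]; exact P.scan_ruleL_id rfl (fun k' j h => by simp [armed, hi] at h) (fun g j h => by simp [armed, hi] at h) _) a]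
  have hstep : P.stepConf c = Finsupp.single { P.commit c with res := PopRes.notpop, queue := c.queue ++ [b] } 1 := by
    simp [stepConf, hi, commit]
  rw [hstep, Finsupp.sum_single_index (by simp), mul_one,
    P.enc_succ _ (by simpa using hs) (by simp [commit]; omega) (by simp [commit, hok.fits.hist_eq]; omega)
      (fun k' => by simpa [commit] using hok.fits.regs_le k')]
  congr 1

/-- **One sweep, `qrot`.** [cite: NishimuraOzawa2002, Lemma 5.1] -/
theorem dynStep_enc_qrot (c : P.Conf) (hok : P.StepOK n s c) {j : ℕ}
    (hi : P.instr (P.next (c.cur, c.res)) = some (QInstr.qrot j)) (a : ℂ) :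
    P.spec.dynStep P.pad P.pad (Finsupp.single (P.enc n s c) a) =
      (P.stepConf c).sum fun c' m => Finsupp.single (P.enc n (s + 1) c') (a * m) := by
  have hs := hok.fits.one_le
  have hh : c.hist.length < n + s := by rw [hok.fits.hist_eq]; omega
  obtain ⟨hne, hroom⟩ := hok.qrot_ok j hi
  obtain ⟨a₀, rest, hq⟩ : ∃ a₀ rest, c.queue = a₀ :: rest := by
    cases h : c.queue with
    | nil => exact absurd h hne
    | cons x l => exact ⟨x, l, rfl⟩
  set cX : P.Conf := { c with queue := rest ++ [a₀], dead := c.dead + 1 } with hcX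
  set cH : P.Conf := { cX with hist := c.hist ++ [(c.cur, c.res)] } with hcH
  have hop := P.scan_opRAt_qrot (s := s) (n := n) hi c hq hs hroom
  have hql : c.queue.length = rest.length + 1 := by rw [hq]; rfl
  have hsetH : List.zipWith P.setH (P.cells n s cX) (P.hcol n s (P.commit c)) = P.cells n s cH := by
    rw [show P.hcol n s (P.commit c) = P.hcol n s cH by simp [hcol, commit, hcH]]
    exact P.zipWith_setH_cells cX cH rfl rfl rfl (P.length_hcol cH (by simp [hcH, hcX]; omega) hs)
  rw [P.dynStep_single_of_det c hs hh (pk := c.parked) (csR := P.cells n s cX) (by rw [hop])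
    (fun g j h => by rw [hi] at h; cases h)
    (φL := P.armed (P.next (c.cur, c.res)) c.parked) (csL := P.pad :: (P.cells n s cH).reverse)
    (by rw [hsetH]; exact P.scan_ruleL_id rfl (fun k' j h => by simp [armed, hi] at h) (fun g j h => by simp [armed, hi] at h) _) a]
  have hstep : P.stepConf c = Finsupp.single { P.commit c with res := PopRes.notpop, queue := rest ++ [a₀], dead := c.dead + 1 } 1 := by
    simp [stepConf, hi, commit, hq]
  rw [hstep, Finsupp.sum_single_index (by simp), mul_one,
    P.enc_succ _ (by simpa using hs) (by simp; omega) (by simp [commit, hok.fits.hist_eq]; omega)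
      (fun k' => by simpa [commit] using hok.fits.regs_le k')]
  congr 1

/-- **One sweep, `qread`.** [cite: NishimuraOzawa2002, Lemma 5.1] -/
theorem dynStep_enc_qread (c : P.Conf) (hok : P.StepOK n s c) {j : ℕ}
    (hi : P.instr (P.next (c.cur, c.res)) = some (QInstr.qread j)) (a : ℂ) :
    P.spec.dynStep P.pad P.pad (Finsupp.single (P.enc n s c) a) =
      (P.stepConf c).sum fun c' m => Finsupp.single (P.enc n (s + 1) c') (a * m) := by
  have hs := hok.fits.one_le
  have hh : c.hist.length < n + s := by rw [hok.fits.hist_eq]; omega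
  obtain ⟨hne, hp⟩ := hok.qread_ok j hi
  obtain ⟨a₀, rest, hq⟩ : ∃ a₀ rest, c.queue = a₀ :: rest := by
    cases h : c.queue with
    | nil => exact absurd h hne
    | cons x l => exact ⟨x, l, rfl⟩
  set cX : P.Conf := { c with queue := rest, dead := c.dead + 1 } with hcX
  set cH : P.Conf := { cX with hist := c.hist ++ [(c.cur, c.res)] } with hcH
  have hop := P.scan_opRAt_qread (s := s) (n := n) hi c hq hp hs hok.fits.queue_le
  have hql : c.queue.length = rest.length + 1 := by rw [hq]; rfl
  have hsetH : List.zipWith P.setH (P.cells n s cX) (P.hcol n s (P.commit c)) = P.cells n s cH := by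
    rw [show P.hcol n s (P.commit c) = P.hcol n s cH by simp [hcol, commit, hcH]]
    exact P.zipWith_setH_cells cX cH rfl rfl rfl (P.length_hcol cH (by simp [hcH, hcX]; omega) hs)
  rw [P.dynStep_single_of_det c hs hh (pk := [a₀]) (csR := P.cells n s cX) (by rw [hop])
    (fun g j h => by rw [hi] at h; cases h)
    (φL := P.armed (P.next (c.cur, c.res)) [a₀]) (csL := P.pad :: (P.cells n s cH).reverse)
    (by rw [hsetH]; exact P.scan_ruleL_id rfl (fun k' j h => by simp [armed, hi] at h) (fun g j h => by simp [armed, hi] at h) _) a]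
  have hstep : P.stepConf c =
      Finsupp.single { P.commit c with res := PopRes.notpop, queue := rest, dead := c.dead + 1, parked := [a₀] } 1 := by
    simp [stepConf, hi, commit, hq]
  have hqle := hok.fits.queue_le
  rw [hstep, Finsupp.sum_single_index (by simp), mul_one,
    P.enc_succ _ (by simpa using hs) (by simp; omega) (by simp [commit, hok.fits.hist_eq]; omega)
      (fun k' => by simpa [commit] using hok.fits.regs_le k')]
  congr 1

/-- **One sweep, `pop k`.** [cite: BernsteinVaziraniSICOMP1997, §4] -/
theorem dynStep_enc_pop (c : P.Conf) (hok : P.StepOK n s c) {k : Fin P.K} {j : Option Bool → ℕ}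
    (hi : P.instr (P.next (c.cur, c.res)) = some (QInstr.pop k j)) (a : ℂ) :
    P.spec.dynStep P.pad P.pad (Finsupp.single (P.enc n s c) a) =
      (P.stepConf c).sum fun c' m => Finsupp.single (P.enc n (s + 1) c') (a * m) := by
  have hs := hok.fits.one_le
  have hh : c.hist.length < n + s := by rw [hok.fits.hist_eq]; omega
  set cH : P.Conf := { c with hist := c.hist ++ [(c.cur, c.res)] } with hcH
  set cL : P.Conf := { cH with regs := Function.update c.regs k (c.regs k).tail } with hcL
  have hsetH : List.zipWith P.setH (P.cells n s c) (P.hcol n s (P.commit c)) = P.cells n s cH := by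
    rw [show P.hcol n s (P.commit c) = P.hcol n s cH by simp [hcol, commit, hcH]]
    exact P.zipWith_setH_cells c cH rfl rfl rfl (P.length_hcol cH (by simp [hcH]; omega) hs)
  have hL := P.scan_ruleL_pop (s := s) (n := n) hi cH c.parked hs (fun k' => by simpa [hcH] using hok.fits.regs_le k')
  rw [P.dynStep_single_of_det c hs hh (pk := c.parked) (csR := P.cells n s c) (P.scan_opRAt_id (P.opRAt_pop hi) _ _)
    (fun g j h => by rw [hi] at h; cases h)
    (φL := ⟨false, P.next (c.cur, c.res), some (P.next (c.cur, c.res), PopRes.popped (c.regs k).head?), false, Micro.idle,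
      ⟨c.parked.take P.amax, by simp⟩⟩) (csL := P.pad :: (P.cells n s cL).reverse)
    (by rw [hsetH]; exact hL) a]
  have hstep : P.stepConf c = Finsupp.single
      { P.commit c with res := PopRes.popped (c.regs k).head?, regs := Function.update c.regs k (c.regs k).tail } 1 := by
    simp [stepConf, hi, commit]
  have hrL : ∀ k', (Function.update c.regs k (c.regs k).tail k').length ≤ n + s := fun k' => by
    by_cases hk : k' = k
    · subst hk; have := hok.fits.regs_le k'; simp; omega
    · simp [hk, hok.fits.regs_le k']
  rw [hstep, Finsupp.sum_single_index (by simp), mul_one,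
    P.enc_succ _ (by simpa using hs) (by simpa [commit] using hok.fits.queue_le) (by simp [commit, hok.fits.hist_eq]; omega)
      (fun k' => by simpa [commit] using hrL k')]
  congr 1

/-! ### One sweep, gate instructions -/

/-- The qubit track of cells rewritten on the qubit track. [folklore] -/
theorem map_getQ_zipWith_setQ (cs : List P.Cell) (A : List (TSym Bool)) (h : A.length = cs.length) :
    (List.zipWith P.setQ cs A).map P.getQ = A := by
  refine List.ext_getElem (by simp [h]) fun i h₁ h₂ => ?_
  simp [List.getElem_zipWith, getQ]

/-- Rewriting the qubit track twice. [folklore] -/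
theorem zipWith_setQ_setQ (cs : List P.Cell) (A B : List (TSym Bool)) :
    List.zipWith P.setQ (List.zipWith P.setQ cs A) B = List.zipWith P.setQ cs (List.zipWith (fun _ b => b) A B) := by
  induction cs generalizing A B with
  | nil => simp
  | cons c cs ih =>
    cases A with
    | nil => simp
    | cons a A => cases B with
      | nil => simp
      | cons b B => simp [ih]

/-- Rewriting the history track and the qubit track commute. [folklore] -/
theorem zipWith_setH_setQ (cs : List P.Cell) (A : List (TSym Bool)) (B : List (TSym P.HSym)) :
    List.zipWith P.setH (List.zipWith P.setQ cs A) B = List.zipWith P.setQ (List.zipWith P.setH cs B) A := by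
  induction cs generalizing A B with
  | nil => simp
  | cons c cs ih =>
    cases A with
    | nil => cases B <;> simp
    | cons a A => cases B with
      | nil => simp
      | cons b B => simp [ih]

/-- `zipWith` keeping the second list. [folklore] -/
theorem zipWith_snd {α β : Type} (A : List α) (B : List β) (h : A.length = B.length) : List.zipWith (fun _ b => b) A B = B := by
  induction A generalizing B with
  | nil => cases B <;> simp_all
  | cons a A ih => cases B with
    | nil => simp at h
    | cons b B => simp at h; simp [ih B h]

/-- On registers executing `qgate g j`, the leftward rule is the lifted return. [folklore] -/
theorem ruleLFun_qgate {φ : P.Reg} (hini : φ.ini = false) {g : P.G.Op} {j : ℕ}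
    (hi : P.instr φ.cur = some (QInstr.qgate g j)) (c : P.Cell) :
    P.ruleLFun (φ, c) = liftRule (P.retPerm (P.G.arity g)) P.decPark P.encPark P.getQ P.setQ (φ, c) := by
  unfold ruleLFun
  rw [if_neg (by simp [hini])]
  simp only [hi]

/-- The length of the gathered column. [folklore] -/
theorem length_gcol (c : P.Conf) (k : ℕ) (hk : k ≤ c.queue.length) (h : c.dead + c.queue.length ≤ n + s) (hs : 1 ≤ s) :
    (P.gcol n s c k).length = n + 2 * s := by
  simp [gcol]; omega

/-- **Leftward pass, `qgate g` (return)**: the gated qubits `z` fill the holes; nothing is parked any more. [cite: NishimuraOzawa2002, Lemma 5.1] -/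
theorem scan_ruleL_ret {cur' : P.PC} {g : P.G.Op} {j : ℕ} (hi : P.instr cur' = some (QInstr.qgate g j)) (c : P.Conf)
    (z : QReg (P.G.arity g)) (hs : 1 ≤ s) (hq : c.queue ≠ []) (hk : P.G.arity g ≤ c.queue.length)
    (hfit : c.dead + c.queue.length ≤ n + s) :
    scan P.spec.ruleL (P.withParked (P.armed cur' []) (P.arity_le g) z)
      (P.pad :: (List.zipWith P.setQ (P.cells n s c) (P.gcol n s c (P.G.arity g))).reverse) =
      (P.armed cur' [], P.pad :: (P.cells n s { c with queue := List.ofFn z ++ c.queue.drop (P.G.arity g) }).reverse) := by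
  have hka := P.arity_le g
  have hdec : P.decPark (P.armed cur' []) = some ⟨[], by simp⟩ := by simp [decPark, armed]
  have hlift := scan_lift (P.retPerm (P.G.arity g)) P.spec.ruleL (P.encPark (P.armed cur' [])) P.getQ P.setQ
    (fun st cell => by
      rw [show P.spec.ruleL (P.encPark (P.armed cur' []) st, cell) = P.ruleLFun (P.encPark (P.armed cur' []) st, cell) from rfl,
        P.ruleLFun_qgate (φ := P.encPark (P.armed cur' []) st) rfl (g := g) (j := j) hi]
      exact liftRule_enc P.liftLaws_park (P.armed cur' []) _ hdec st cell)
    ⟨List.ofFn z, by simpa using hka⟩ (P.pad :: (List.zipWith P.setQ (P.cells n s c) (P.gcol n s c (P.G.arity g))).reverse)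
  rw [show P.encPark (P.armed cur' []) ⟨List.ofFn z, by simpa using hka⟩ = P.withParked (P.armed cur' []) hka z from rfl]
    at hlift
  have hlenA : (P.gcol n s c (P.G.arity g)).length = (P.cells n s c).length := by
    rw [P.length_gcol c (P.G.arity g) hk hfit hs, P.length_cells]
  rw [hlift, List.map_cons, List.map_reverse, P.map_getQ_zipWith_setQ _ _ hlenA, show P.getQ P.pad = TSym.free from rfl,
    ← List.reverse_concat']
  set cZ : P.Conf := { c with queue := List.ofFn z ++ c.queue.drop (P.G.arity g) } with hcZ
  have hqZ : cZ.queue.length = c.queue.length := by simp [hcZ]; omega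
  have hlenZ : (P.qcol n s cZ).length = n + 2 * s := P.length_qcol cZ (by rw [hqZ]; exact hfit) hs
  -- the return on the reversed column
  have hz : (List.ofFn z).length = P.G.arity g := by simp
  have hscanv : scan (fun x : List Bool × TSym Bool => if h : x.1.length ≤ P.amax then
      ((P.retPerm (P.G.arity g) (⟨x.1, h⟩, x.2)).1.1, (P.retPerm (P.G.arity g) (⟨x.1, h⟩, x.2)).2) else x) (List.ofFn z)
      (P.gcol n s c (P.G.arity g) ++ [TSym.free]).reverse = ([], (P.qcol n s cZ ++ [TSym.free]).reverse) := by
    rw [gcol, qcol, hqZ, List.append_assoc, ← frees_succ', List.append_assoc _ (frees _), ← frees_succ']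
    rcases eq_or_ne (c.queue.drop (P.G.arity g)) [] with hrest | hrest
    · have hKq : P.G.arity g = c.queue.length := by
        have := List.drop_eq_nil_iff.1 hrest; omega
      have hK0 : P.G.arity g ≠ 0 := by
        intro h0; apply hq; rw [← List.length_eq_zero_iff]; omega
      obtain ⟨m, hm⟩ : ∃ m, P.G.arity g = m + 1 := Nat.exists_eq_succ_of_ne_zero hK0
      rw [show cZ.queue = List.ofFn z ++ c.queue.drop (P.G.arity g) from rfl, show cZ.dead = c.dead from rfl, hrest,
        List.append_nil]
      generalize List.ofFn z = l at hz ⊢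
      rw [hm] at hz hka ⊢
      exact scan_ret_nil (P.extends_retPerm_val hka) (s - 1) (n + s - c.dead - c.queue.length + 1) c.dead l hz
    · exact scan_ret_of_ne_nil (P.extends_retPerm_val hka) (s - 1) _ c.dead (List.ofFn z) _ hz hrest
  rw [show List.ofFn z = (⟨List.ofFn z, by simpa using hka⟩ : BList P.amax).1 from rfl, P.scan_val] at hscanv
  simp only [Prod.mk.injEq] at hscanv
  obtain ⟨h1, h2⟩ := hscanv
  refine Prod.ext ?_ ?_
  · show P.encPark (P.armed cur' []) _ = P.armed cur' []
    rw [show (scan (P.retPerm (P.G.arity g)) ⟨List.ofFn z, by simpa using hka⟩ _).1 = (⟨[], by simp⟩ : BList P.amax) from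
      Subtype.ext h1]
    simp [encPark, armed]
  · show List.zipWith P.setQ (P.pad :: (List.zipWith P.setQ (P.cells n s c) (P.gcol n s c (P.G.arity g))).reverse) _ = _
    rw [h2, List.reverse_concat', List.zipWith_cons_cons,
      ← reverse_zipWith _ _ _ (by rw [List.length_zipWith, hlenA, min_self, hlenZ, P.length_cells]),
      show P.setQ P.pad TSym.free = P.pad from rfl, P.zipWith_setQ_setQ,
      zipWith_snd _ _ (by rw [hlenA, hlenZ, P.length_cells]), P.zipWith_setQ_cells c cZ rfl rfl hlenZ]

/-- `vecOf` does not depend on the presentation of the list. [folklore] -/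
theorem vecOf_congr {k : ℕ} {l l' : List Bool} (h : l = l') (hl : l.length = k) (hl' : l'.length = k) :
    vecOf l hl = vecOf l' hl' := by subst h; rfl

/-- **One sweep, `qgate g`**: gather, the gate on the parked register at the turn, return —
the superposition of the abstract step. [cite: NishimuraOzawa2002, Lemma 5.1] -/
theorem dynStep_enc_qgate (c : P.Conf) (hok : P.StepOK n s c) {g : P.G.Op} {j : ℕ}
    (hi : P.instr (P.next (c.cur, c.res)) = some (QInstr.qgate g j)) (a : ℂ) :
    P.spec.dynStep P.pad P.pad (Finsupp.single (P.enc n s c) a) =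
      (P.stepConf c).sum fun c' m => Finsupp.single (P.enc n (s + 1) c') (a * m) := by
  classical
  have hs := hok.fits.one_le
  have hh : c.hist.length < n + s := by rw [hok.fits.hist_eq]; omega
  obtain ⟨hp, hne, hk⟩ := hok.qgate_ok g j hi
  have hka : P.G.arity g ≤ P.amax := P.arity_le g
  have hpkl : (c.queue.take (P.G.arity g)).length = P.G.arity g := by simp; omega
  have hpkt : (c.queue.take (P.G.arity g)).take P.amax = c.queue.take (P.G.arity g) :=
    List.take_of_length_le (by rw [hpkl]; exact hka)
  set cH : P.Conf := { c with hist := c.hist ++ [(c.cur, c.res)] } with hcH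
  -- the rightward pass
  have hop := P.scan_opRAt_qgate (s := s) (n := n) hi c hp hne hk hs hok.fits.queue_le
  have hcsR : List.zipWith P.setH (List.zipWith P.setQ (P.cells n s c) (P.gcol n s c (P.G.arity g))) (P.hcol n s (P.commit c)) =
      List.zipWith P.setQ (P.cells n s cH) (P.gcol n s cH (P.G.arity g)) := by
    rw [P.zipWith_setH_setQ, show P.hcol n s (P.commit c) = P.hcol n s cH by simp [hcol, commit, hcH],
      P.zipWith_setH_cells c cH rfl rfl rfl (P.length_hcol cH (by simp [hcH]; omega) hs)]
    rfl
  have hR : scan P.spec.ruleR (P.reg c) (P.cells n s c) =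
      (P.postR (P.next (c.cur, c.res)) (c.queue.take (P.G.arity g)), List.zipWith P.setQ (P.cells n s cH) (P.gcol n s cH (P.G.arity g))) := by
    rw [P.scan_ruleR_enc c hh hop hs, hcsR]; rfl
  -- the turn
  have hg : P.gateOf (P.armed (P.next (c.cur, c.res)) (c.queue.take (P.G.arity g))) = some g := by simp [gateOf, armed, hi]
  have hlen : (P.armed (P.next (c.cur, c.res)) (c.queue.take (P.G.arity g))).parked.1.length = P.G.arity g := by simp [armed, hpkt, hpkl]
  have hturn : ∀ ψ, P.spec.turnAmp (P.reg c) (P.cells n s c) ψ = P.gateAmp (P.armed (P.next (c.cur, c.res)) (c.queue.take (P.G.arity g))) ψ := by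
    intro ψ
    show P.turn (scan P.spec.ruleR (P.reg c) (P.cells n s c)).1 ψ = _
    rw [hR]
    show P.gateAmp (P.turnσ (P.postR (P.next (c.cur, c.res)) (c.queue.take (P.G.arity g)))) ψ = _
    rw [P.turnσ_postR]
  -- the leftward pass, for each outcome `z` of the gate
  have hL : ∀ z : QReg (P.G.arity g), P.spec.sweepOut P.pad P.pad (P.reg c) (P.cells n s c) (P.withParked (P.armed (P.next (c.cur, c.res)) (c.queue.take (P.G.arity g))) hka z) =
      (P.armed (P.next (c.cur, c.res)) [], P.pad :: (P.pad :: (P.cells n s { cH with queue := List.ofFn z ++ c.queue.drop (P.G.arity g) }).reverse).reverse) := by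
    intro z
    show ((scan P.spec.ruleL (P.withParked (P.armed (P.next (c.cur, c.res)) (c.queue.take (P.G.arity g))) hka z) (P.pad :: (scan P.spec.ruleR (P.reg c) (P.cells n s c)).2.reverse)).1,
      P.pad :: ((scan P.spec.ruleL (P.withParked (P.armed (P.next (c.cur, c.res)) (c.queue.take (P.G.arity g))) hka z)
        (P.pad :: (scan P.spec.ruleR (P.reg c) (P.cells n s c)).2.reverse)).2).reverse) = _
    rw [hR]
    simp only
    rw [show P.withParked (P.armed (P.next (c.cur, c.res)) (c.queue.take (P.G.arity g))) hka z = P.withParked (P.armed (P.next (c.cur, c.res)) []) (P.arity_le g) z from rfl,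
      P.scan_ruleL_ret hi cH z hs (by simpa [hcH] using hne) (by simpa [hcH] using hk) (by simpa [hcH] using hok.fits.queue_le)]
  -- summing up
  unfold SweepSpec.dynStep
  rw [Finsupp.sum_single_index (by simp)]
  simp only [enc]
  simp_rw [hturn]
  set f : P.Reg → (P.Reg × List P.Cell) →₀ ℂ := fun ψ => Finsupp.single (P.spec.sweepOut P.pad P.pad (P.reg c) (P.cells n s c) ψ)
    (a * if h : ψ.parked.1.length = P.G.arity g then P.G.mat g (vecOf ψ.parked.1 h) (vecOf (P.armed (P.next (c.cur, c.res)) (c.queue.take (P.G.arity g))).parked.1 hlen) else 0) with hf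
  have hsummand : ∀ ψ, Finsupp.single (P.spec.sweepOut P.pad P.pad (P.reg c) (P.cells n s c) ψ) (a * P.gateAmp (P.armed (P.next (c.cur, c.res)) (c.queue.take (P.G.arity g))) ψ) =
      if P.SameButParked (P.armed (P.next (c.cur, c.res)) (c.queue.take (P.G.arity g))) ψ ∧ ψ.parked.1.length = P.G.arity g then f ψ else 0 := by
    intro ψ
    rw [P.gateAmp_of_inGate hg hlen]
    by_cases h' : P.SameButParked (P.armed (P.next (c.cur, c.res)) (c.queue.take (P.G.arity g))) ψ ∧ ψ.parked.1.length = P.G.arity g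
    · rw [dif_pos h', if_pos h', hf]; simp only; rw [dif_pos h'.2]
    · rw [dif_neg h', if_neg h', mul_zero, Finsupp.single_zero]
  simp_rw [hsummand]
  rw [P.sum_block (P.armed (P.next (c.cur, c.res)) (c.queue.take (P.G.arity g))) hka f]
  have hfz : ∀ z : QReg (P.G.arity g), f (P.withParked (P.armed (P.next (c.cur, c.res)) (c.queue.take (P.G.arity g))) hka z) =
      Finsupp.single (P.armed (P.next (c.cur, c.res)) [], P.pad :: (P.pad :: (P.cells n s { cH with queue := List.ofFn z ++ c.queue.drop (P.G.arity g) }).reverse).reverse)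
        (a * P.G.mat g z (vecOf (P.armed (P.next (c.cur, c.res)) (c.queue.take (P.G.arity g))).parked.1 hlen)) := by
    intro z
    rw [hf]; simp only
    rw [hL z, dif_pos (by simp [withParked])]
    simp only [withParked, vecOf_ofFn]
  simp_rw [hfz]
  -- the abstract step
  have hstep : P.stepConf c = ∑ z : QReg (P.G.arity g),
      Finsupp.single { P.commit c with res := PopRes.notpop, queue := List.ofFn z ++ c.queue.drop (P.G.arity g) }
        (P.G.mat g z (vecOf (c.queue.take (P.G.arity g)) hpkl)) := by
    simp only [stepConf, commit, hi, dif_pos hk]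
  rw [hstep, ← Finsupp.sum_finsetSum_index (by simp) (by intros; simp [mul_add])]
  refine Finset.sum_congr rfl fun z _ => ?_
  rw [Finsupp.sum_single_index (by simp),
    P.cells_succ _ (by simpa using hs)
      (by show c.dead + (List.ofFn z ++ c.queue.drop (P.G.arity g)).length ≤ n + s
          have := hok.fits.queue_le; simp; omega)
      (by simp [commit, hok.fits.hist_eq]; omega)
      (fun k' => by simpa [commit] using hok.fits.regs_le k')]
  congr 1
  · simp only [List.reverse_cons, List.reverse_reverse, Prod.mk.injEq]
    exact ⟨by simp [armed, reg, commit, hp], rfl⟩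
  · congr 2
    exact vecOf_congr (by simp [armed, hpkt]) _ _

/-- **One sweep of the machine on an encoded configuration is the encoded abstract step.** [cite: NishimuraOzawa2002, Lemma 5.1] -/
theorem dynStep_enc (c : P.Conf) (hok : P.StepOK n s c) (a : ℂ) :
    P.spec.dynStep P.pad P.pad (Finsupp.single (P.enc n s c) a) =
      (P.stepConf c).sum fun c' m => Finsupp.single (P.enc n (s + 1) c') (a * m) := by
  rcases hi : P.instr (P.next (c.cur, c.res)) with _ | ⟨k, b⟩ | ⟨k, j⟩ | j | ⟨b, j⟩ | j | ⟨g, j⟩ | j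
  · exact P.dynStep_enc_halt c hok hi a
  · exact P.dynStep_enc_push c hok hi a
  · exact P.dynStep_enc_pop c hok hi a
  · exact P.dynStep_enc_goto c hok hi a
  · exact P.dynStep_enc_qpush c hok hi a
  · exact P.dynStep_enc_qrot c hok hi a
  · exact P.dynStep_enc_qgate c hok hi a
  · exact P.dynStep_enc_qread c hok hi a

/-! ### The first sweep -/

/-- The init rule marks the input cells as `1`s of register `U`, without changing the state. [folklore] -/
theorem iniRule_inp (b : Bool) : P.iniRule (P.iniReg, P.inp b) = (P.iniReg, P.setR P.U (P.inp b) (TSym.cell (Base.sym true) false)) := by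
  rw [iniRule_apply]
  simp [iniReg, inp]

/-- The input cell after the first pass. [folklore] -/
def inp₁ (b : Bool) : P.Cell := P.setR P.U (P.inp b) (TSym.cell (Base.sym true) false)

/-- **The rightward pass of the first sweep.** [folklore] -/
theorem scan_ruleR_ini (x : List Bool) : scan P.spec.ruleR P.iniReg (x.map P.inp) = (P.iniReg, x.map P.inp₁) := by
  rw [scan_map_of_fixed P.spec.ruleR P.iniReg (x.map P.inp) (fun c => P.setR P.U c (TSym.cell (Base.sym true) false))
    (fun c hc => by
      obtain ⟨b, -, rfl⟩ := List.mem_map.1 hc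
      show P.ruleRFun (P.iniReg, P.inp b) = _
      unfold ruleRFun
      rw [if_pos (show (P.iniReg, P.inp b).1.ini = true from rfl), P.iniRule_inp]), List.map_map]
  rfl

/-- The register after the first turn is the boundary register of the first configuration. [folklore] -/
theorem turnσ_iniReg' (x : List Bool) : P.turnσ P.iniReg = P.reg (P.conf₁ x) := by
  rw [P.turnσ_iniReg]; simp [reg₁, reg, conf₁]

/-- Instruction `0` is `goto 1`. [folklore] -/
theorem instr_zero : P.instr 0 = some (QInstr.goto 1) := by
  have h := P.code_head
  cases hc : P.code with
  | nil => rw [hc] at h; simp at h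
  | cons i l => rw [hc] at h; simp at h; subst h; simp [instr, hc]

/-- **The first sweep**: the input is copied into register `U` as `1`s (the input itself is the
queue, read classically), the run starts in the first configuration. [cite: NishimuraOzawa2002, Lemma 5.1] -/
theorem dynStep_ini (x : List Bool) :
    P.spec.dynStep P.anchorL P.anchorR (Finsupp.single (P.iniReg, x.map P.inp) 1) =
      Finsupp.single (P.reg (P.conf₁ x), P.anchorL :: (x.map P.inp₁ ++ [P.anchorR])) 1 := by
  classical
  have hturn : ∀ ψ, P.spec.turnAmp P.iniReg (x.map P.inp) ψ = if P.reg (P.conf₁ x) = ψ then 1 else 0 := by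
    intro ψ
    show P.turn (scan P.spec.ruleR P.iniReg (x.map P.inp)).1 ψ = _
    rw [P.scan_ruleR_ini]
    show P.gateAmp (P.turnσ P.iniReg) ψ = _
    rw [P.turnσ_iniReg' x]
    refine P.gateAmp_of_not_inGate (fun g hg => ?_) ψ
    exfalso
    simp [gateOf, reg, conf₁, P.instr_zero] at hg
  unfold SweepSpec.dynStep
  rw [Finsupp.sum_single_index (by simp)]
  simp_rw [hturn]
  rw [Finset.sum_eq_single (P.reg (P.conf₁ x)) (fun ψ _ hψ => by rw [if_neg (Ne.symm hψ), mul_zero, Finsupp.single_zero])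
    (fun h => absurd (Finset.mem_univ _) h), if_pos rfl, mul_one]
  congr 1
  show ((scan P.spec.ruleL (P.reg (P.conf₁ x)) (P.anchorR :: (scan P.spec.ruleR P.iniReg (x.map P.inp)).2.reverse)).1,
    P.anchorL :: ((scan P.spec.ruleL (P.reg (P.conf₁ x)) (P.anchorR :: (scan P.spec.ruleR P.iniReg (x.map P.inp)).2.reverse)).2).reverse) = _
  rw [P.scan_ruleR_ini, P.scan_ruleL_id rfl (fun k j h => by simp [reg, conf₁, P.instr_zero] at h)
    (fun g j h => by simp [reg, conf₁, P.instr_zero] at h)]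
  simp

/-- **Cells are determined by their columns.** [folklore] -/
theorem cells_eq_of_columns (c : P.Conf) (L : List P.Cell) (hlen : L.length = n + 2 * s)
    (ht : L.map Cell.tag = tagcol n s) (hq : L.map P.getQ = P.qcol n s c) (hh : L.map P.getH = P.hcol n s c)
    (hr : ∀ k, L.map (P.getR k) = P.rcol n s c k) : P.cells n s c = L := by
  refine List.ext_getElem (by simp [hlen]) fun i h₁ h₂ => ?_
  rw [P.getElem_cells c i h₁, ← ht, ← hq, ← hh]
  have hr' : ∀ k, (P.rcol n s c k)[i]?.getD TSym.free = L[i].regs k := fun k => by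
    rw [← hr k]; simp [List.getElem?_eq_getElem h₂, getR]
  simp only [List.getD_eq_getElem?_getD, List.getElem?_map, List.getElem?_eq_getElem h₂, Option.map_some, Option.getD_some,
    getQ, getH, hr']

/-- **The cells at the first boundary** are the anchors around the marked input. [folklore] -/
theorem cells_one (x : List Bool) : P.cells x.length 1 (P.conf₁ x) = P.anchorL :: (x.map P.inp₁ ++ [P.anchorR]) := by
  refine P.cells_eq_of_columns _ _ (by simp) ?_ ?_ ?_ fun k => ?_
  · simp [tagcol, anchorL, anchorR, inp₁, inp, setR, Function.comp_def, List.replicate_succ]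
  · have : Base.anc :: qbody 0 (x ++ [false]) = (Base.anc :: x.map Base.sym) ++ [Base.sym false] := by simp [qbody]
    simp only [qcol, conf₁, Nat.sub_self, List.replicate_zero, List.nil_append, List.length_append, List.length_singleton,
      seg, this, hatLast_append_singleton]
    simp [anchorL, anchorR, inp₁, inp, setR, getQ, Function.comp_def]
  · simp [hcol, conf₁, seg, anchorL, anchorR, inp₁, inp, setR, getH, Function.comp_def, List.replicate_succ']
  · by_cases hk : k = P.U
    · subst hk
      have : Base.anc :: (List.replicate (x.length + 1) true).reverse.map Base.sym =
          (Base.anc :: List.replicate x.length (Base.sym true)) ++ [Base.sym true] := by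
        simp [List.replicate_succ]
      simp only [rcol, conf₁, if_true, Nat.sub_self, List.replicate_zero, List.nil_append, List.length_replicate, seg, this,
        hatLast_append_singleton]
      simp [anchorL, anchorR, inp₁, inp, setR, getR, Function.comp_def]
    · simp [rcol, conf₁, hk, seg, anchorL, anchorR, inp₁, inp, setR, getR, Function.comp_def, List.replicate_succ']

/-- **The first sweep lands on the encoding of the first configuration.** [cite: NishimuraOzawa2002, Lemma 5.1] -/
theorem dynRun_one (x : List Bool) : P.spec.dynRun x 1 = Finsupp.single (P.enc x.length 1 (P.conf₁ x)) 1 := by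
  show P.spec.dynStep P.anchorL P.anchorR (Finsupp.single (P.iniReg, x.map P.inp) 1) = _
  rw [P.dynStep_ini, enc, P.cells_one]

/-! ### The run -/

/-- **The abstract run**: the superposition of configurations after `s` sweeps beyond the first. [cite: NishimuraOzawa2002, Lemma 5.1] -/
noncomputable def confRun (x : List Bool) : ℕ → (P.Conf →₀ ℂ)
  | 0 => Finsupp.single (P.conf₁ x) 1
  | s + 1 => (confRun x s).sum fun c a => (P.stepConf c).sum fun c' m => Finsupp.single c' (a * m)

/-- **The run theorem**: as long as every configuration reached satisfies the room and shape
conditions of its step, the machine after `s + 1` sweeps is in the encoded abstract run. [cite: NishimuraOzawa2002, Lemma 5.1] -/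
theorem dynRun_eq (x : List Bool) (hok : ∀ s c, c ∈ (P.confRun x s).support → P.StepOK x.length (s + 1) c) (s : ℕ) :
    P.spec.dynRun x (s + 1) = (P.confRun x s).sum fun c a => Finsupp.single (P.enc x.length (s + 1) c) a := by
  induction s with
  | zero => rw [P.dynRun_one, confRun, Finsupp.sum_single_index (by simp)]
  | succ s ih =>
    show P.spec.dynStep P.pad P.pad (P.spec.dynRun x (s + 1)) = _
    rw [ih, confRun, SweepSpec.dynStep, Finsupp.sum_sum_index (by simp) (by intros; simp [add_mul, Finset.sum_add_distrib]),
      Finsupp.sum_sum_index (by simp) (by intros; simp)]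
    refine Finsupp.sum_congr fun c hc => ?_
    rw [Finsupp.sum_single_index (by simp), Finsupp.sum_sum_index (by simp) (by intros; simp)]
    have := P.dynStep_enc (n := x.length) (s := s + 1) c (hok s c hc) ((P.confRun x s) c)
    rw [SweepSpec.dynStep, Finsupp.sum_single_index (by simp)] at this
    rw [this]
    refine Finsupp.sum_congr fun c' _ => ?_
    rw [Finsupp.sum_single_index (by simp)]

/-! ### Decoding: the encoding is one-to-one on fitting configurations -/

section Decode

variable {α : Type}

/-- The data symbols of a track, in order. [folklore] -/
def syms : List (TSym α) → List α
  | [] => []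
  | TSym.cell (Base.sym a) _ :: l => a :: syms l
  | _ :: l => syms l

/-- `syms` of a concatenation. [folklore] -/
theorem syms_append (l l' : List (TSym α)) : syms (l ++ l') = syms l ++ syms l' := by
  induction l with
  | nil => rfl
  | cons t l ih => rcases t with _ | ⟨_ | _ | _ | a, h⟩ <;> simp [syms, ih]

/-- `syms` of free cells. [folklore] -/
@[simp] theorem syms_frees (k : ℕ) : syms (frees k : List (TSym α)) = [] := by
  induction k with
  | zero => rfl
  | succ k ih => rw [show (frees (k + 1) : List (TSym α)) = TSym.free :: frees k from rfl]; simpa [syms] using ih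

/-- `syms` of unhatted cells. [folklore] -/
theorem syms_map_cell (l : List (Base α)) (h : Bool) :
    syms (l.map fun b => TSym.cell b h) = l.filterMap fun b => match b with | Base.sym a => some a | _ => none := by
  induction l with
  | nil => rfl
  | cons b l ih => rcases b with _ | _ | _ | a <;> simp [syms, ih]

/-- `syms` of a segment. [folklore] -/
theorem syms_seg (body : List (Base α)) :
    syms (seg body) = body.filterMap fun b => match b with | Base.sym a => some a | _ => none := by
  obtain ⟨bs, b, hb⟩ : ∃ bs b, Base.anc :: body = bs ++ [b] :=
    ⟨(Base.anc :: body).dropLast, (Base.anc :: body).getLast (by simp), (List.dropLast_append_getLast _).symm⟩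
  rw [seg, hb, hatLast_append_singleton, syms_append, syms_map_cell]
  have : (Base.anc :: body).filterMap (fun b => match b with | Base.sym a => some a | _ => none) =
      body.filterMap fun b => match b with | Base.sym a => some a | _ => none := by simp
  rw [← this, hb, List.filterMap_append]
  rcases b with _ | _ | _ | a <;> simp [syms]

/-- `filterMap` of the symbol payload over data symbols. [folklore] -/
@[simp] theorem filterMap_sym (l : List α) :
    (l.map Base.sym).filterMap (fun b => match b with | Base.sym a => some a | _ => none) = l := by
  induction l with
  | nil => rfl
  | cons a l ih => simp [ih]

/-- The data of a stack column. [folklore] -/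
theorem syms_rcol (c : P.Conf) (k : Fin P.K) : syms (P.rcol n s c k) = (c.regs k).reverse := by
  rw [rcol, syms_append, syms_append, syms_seg]; simp

/-- The data of the history column. [folklore] -/
theorem syms_hcol (c : P.Conf) : syms (P.hcol n s c) = c.hist := by
  rw [hcol, syms_append, syms_append, syms_seg]; simp

/-- The data of the qubit column. [folklore] -/
theorem syms_qcol (c : P.Conf) : syms (P.qcol n s c) = c.queue := by
  rw [qcol, syms_append, syms_append, syms_seg, qbody, List.filterMap_append]
  simp

/-- Dead cells. [folklore] -/
def isDead : TSym α → Bool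
  | TSym.cell Base.dead _ => true
  | _ => false

/-- The number of dead cells of a track. [folklore] -/
def deads (l : List (TSym α)) : ℕ := l.countP isDead

/-- The dead prefix length from the qubit column. [folklore] -/
theorem deads_qcol (c : P.Conf) : deads (P.qcol n s c) = c.dead := by
  have hfree : ∀ k, deads (frees k : List (TSym Bool)) = 0 := fun k => by simp [deads, List.countP_replicate, isDead]
  have happ : ∀ l l' : List (TSym Bool), deads (l ++ l') = deads l + deads l' := fun l l' => List.countP_append ..
  rw [qcol, happ, happ, hfree, hfree, zero_add, add_zero]
  rcases eq_or_ne c.queue [] with hq | hq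
  · rw [hq]
    rcases Nat.eq_zero_or_pos c.dead with hd | hd
    · rw [hd]; rfl
    · obtain ⟨d, hd'⟩ : ∃ d, c.dead = d + 1 := Nat.exists_eq_succ_of_ne_zero (by omega)
      rw [hd', show seg (qbody (d + 1) ([] : List Bool)) =
        TSym.cell Base.anc false :: (List.replicate d (TSym.cell Base.dead false) ++ [TSym.cell Base.dead true]) by
          rw [seg, show Base.anc :: qbody (d + 1) ([] : List Bool) = (Base.anc :: List.replicate d Base.dead) ++ [Base.dead] by
            simp [qbody, List.replicate_succ'], hatLast_append_singleton]; simp [List.map_replicate]]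
      simp [deads, List.countP_append, List.countP_replicate, isDead]
  · rw [seg_qbody_of_ne_nil _ hq]
    simp [deads, List.countP_append, List.countP_replicate, isDead, symCells, List.countP_map, Function.comp_def]

/-- **The encoding is one-to-one on fitting configurations.** [folklore] -/
theorem enc_injOn {c c' : P.Conf} (hc : P.Fits n s c) (hc' : P.Fits n s c') (h : P.enc n s c = P.enc n s c') : c = c' := by
  have hs := hc.one_le
  simp only [enc, Prod.mk.injEq] at h
  obtain ⟨hreg, hcells⟩ := h
  have hq : P.qcol n s c = P.qcol n s c' := by
    rw [← P.map_getQ_cells c hc.queue_le hs, ← P.map_getQ_cells c' hc'.queue_le hs, hcells]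
  have hh : P.hcol n s c = P.hcol n s c' := by
    rw [← P.map_getH_cells c (by rw [hc.hist_eq]; omega) hs, ← P.map_getH_cells c' (by rw [hc'.hist_eq]; omega) hs, hcells]
  have hr : ∀ k, P.rcol n s c k = P.rcol n s c' k := fun k => by
    rw [← P.map_getR_cells c k (hc.regs_le k) hs, ← P.map_getR_cells c' k (hc'.regs_le k) hs, hcells]
  obtain ⟨cur, res, regs, hist, queue, dead, parked⟩ := c
  obtain ⟨cur', res', regs', hist', queue', dead', parked'⟩ := c'
  simp only [reg, Reg.mk.injEq, Option.some.injEq, Prod.mk.injEq, true_and, Subtype.mk.injEq] at hreg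
  obtain ⟨rfl, ⟨-, rfl⟩, hpk⟩ := hreg
  have hpk' : parked = parked' := by
    have h1 : parked.length ≤ P.amax := hc.parked_le
    have h2 : parked'.length ≤ P.amax := hc'.parked_le
    rw [← List.take_of_length_le h1, ← List.take_of_length_le h2]; exact hpk
  have hqueue : queue = queue' := by simpa [P.syms_qcol] using congrArg syms hq
  have hdead : dead = dead' := by simpa [P.deads_qcol] using congrArg deads hq
  have hhist : hist = hist' := by simpa [P.syms_hcol] using congrArg syms hh
  have hregs : regs = regs' := by
    funext k
    have := congrArg syms (hr k)
    simpa [P.syms_rcol] using this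
  subst hpk' hqueue hdead hhist hregs
  rfl

end Decode

/-! ### The acceptance probability -/

/-- The boundary register is the accepting one iff the machine halted with the bit `1` parked. [folklore] -/
theorem reg_eq_accReg {c : P.Conf} (hp : c.parked.length ≤ P.amax) :
    P.reg c = P.accReg ↔ c.cur = Fin.last P.L ∧ c.res = PopRes.notpop ∧ c.parked = [true] := by
  rw [reg, accReg]
  simp only [Reg.mk.injEq, Option.some.injEq, Prod.mk.injEq, true_and, Subtype.mk.injEq, List.take_of_length_le hp]
  tauto

/-- **The acceptance probability of the machine of `P` after `s + 1` sweeps** is the total weight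
of the halted configurations with `|1⟩` parked in the abstract run. [cite: NishimuraOzawa2002, Lemma 5.1] -/
theorem pacceptProbAt_eq (x : List Bool) (hok : ∀ s c, c ∈ (P.confRun x s).support → P.StepOK x.length (s + 1) c) (s : ℕ) :
    P.machine.pacceptProbAt x (sweepTime x.length (s + 1)) =
      (P.confRun x s).sum fun c a => if c.cur = Fin.last P.L ∧ c.res = PopRes.notpop ∧ c.parked = [true] then ‖a‖ ^ 2 else 0 := by
  classical
  rw [SweepSpec.pacceptProbAt_sweepTime, P.dynRun_eq x hok s]
  have hinj : Set.InjOn (P.enc x.length (s + 1)) ((P.confRun x s).support : Set P.Conf) := fun c hc c' hc' h =>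
    P.enc_injOn (hok s c hc).fits (hok s c' hc').fits h
  rw [show ((P.confRun x s).sum fun c a => Finsupp.single (P.enc x.length (s + 1) c) a) =
    Finsupp.mapDomain (P.enc x.length (s + 1)) (P.confRun x s) from rfl]
  rw [Finsupp.sum, Finsupp.mapDomain_support_of_injOn _ hinj, Finset.sum_image (by simpa [Set.InjOn] using hinj), Finsupp.sum]
  refine Finset.sum_congr rfl fun c hc => ?_
  rw [Finsupp.mapDomain_apply' _ _ subset_rfl hinj hc]
  have hiff := P.reg_eq_accReg (hok s c hc).fits.parked_le
  by_cases h : P.reg c = P.accReg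
  · rw [if_pos (hiff.1 h)]; exact if_pos h
  · rw [if_neg (fun h' => h (hiff.2 h'))]; exact if_neg h

end Prog

end QSM

end QTM

end Literature.Computability.Cryptography
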